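import Mathlib
import Literature.NumberTheory.Automorphic.SelbergTransform

/-!
# The Selberg/Harish-Chandra transform of the lattice kernel: closed form, strip decay, and (12.8)
(Iwaniec, *Spectral Methods of Automorphic Forms*, GSM 53, (1.62)–(1.63), (12.8) and proof of Theorem 12.1, PDF pp. 24, 126)

Fifth layer of the `provefact` decomposition of `Literature.NumberTheory.Automorphic.sl2BallCount_asymp`: Part I is the **discharge of
the named fact `Iwaniec2002_latticeKernel_admissible`** of `SelbergTransform.lean` — the transform `h`
of the test kernel `k = k_{X,Y}` of Fig. 11 satisfies Iwaniec's conditions (1.63) (even, holomorphic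
in `|Im t| ≤ 1/2 + ε`, `h(t) ≪ (|t| + 1)^{-2-ε}`), here with `ε = 1/2`. This is used implicitly on
p. 126 when (12.5) (i.e. Theorem 7.4) is applied to `k`; Part II (below) discharges (12.8).
Everything in this file is proved.

## Contents

1. `coshKernel R r = (cosh R - cosh r)_+^{3/2}` (as `√(cosh R - cosh r)³`), its derivatives
   `coshKernelDeriv`, `coshKernelDeriv2 = (3/4) φ_R - (3/2) χ_R` with
   `φ_R = sinh² / (cosh R - cosh)^{1/2}` (`phiK`) and `χ_R = (cosh R - cosh)^{1/2} cosh` (`chiK`);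
   the endpoint bound `sinh(R/2) (R - |r|) ≤ cosh R - cosh r` (from
   `cosh R - cosh r = 2 sinh((R+r)/2) sinh((R-r)/2)` and `x ≤ sinh x`), whence
   `f_R'' = O_R((R - |r|)^{-1/2})` is integrable on `[-R, R]`.
2. Integration by parts against `e^{irt}` for complex `t` (`integral_cexp_mul_eq`) and the
   resulting identity `(it)² F_R(t) = ∫_{-R}^{R} e^{irt} f_R''(r) dr` for
   `F_R(t) = ∫_{-R}^{R} e^{irt} f_R(r) dr` (`coshKernelFourier`, `sq_mul_coshKernelFourier`).
3. `∫ e^{irt} χ_R ≪ e^{R|Im t|}/|t|` (one more integration by parts) and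
   `∫ e^{irt} φ_R ≪ e^{R|Im t|} |t|^{-1/2}` (the inverse-square-root endpoint singularity: split
   `[0, R] = [0, R - δ] ∪ [R - δ, R]` with `δ = 1/|t|`, by parts on the first piece using
   `φ_R' ≥ 0`, trivially on the second), giving **`F_R(t) ≪_R (|t| + 1)^{-5/2}` in the strip
   `|Im t| < 1`** (`coshKernelFourier_decay`).
4. Closed forms for the lattice kernel (Iwaniec (1.62) computed for Fig. 11):
   `k = (4/Y)((b-u)_+ - (a-u)_+)` with `a = (X-2)/4`, `b = (X+Y-2)/4`;
   `∫_v^∞ (c-u)_+ (u-v)^{-1/2} du = (4/3)(c-v)_+^{3/2}` (`integral_max_sub_mul_rpow`);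
   `q(v) = (16/(3Y))((b-v)_+^{3/2} - (a-v)_+^{3/2})` (`selbergQ_latticeKernel`);
   `g(r) = (16/(3√2 Y))(f_{R_b}(r) - f_{R_a}(r))` with `cosh R_a = X/2`, `cosh R_b = (X+Y)/2`
   (`selbergG_latticeKernel`); `h(t) = (16/(3√2 Y))(F_{R_b}(t) - F_{R_a}(t))`
   (`selbergTransform_latticeKernel`).
5. `Iwaniec2002_latticeKernel_admissible_holds : Iwaniec2002_latticeKernel_admissible`
   (the auxiliary analysis of 1–4 lives in the sub-namespace `Literature.SelbergDecay`).

Part II discharges the second "reader's" fact of `SelbergTransform.lean`,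
**`Iwaniec2002_eq_12_8_holds : Iwaniec2002_eq_12_8`** ((12.8): for `1/2 < s ≤ 1`,
`h(i(s - 1/2)) = π^{1/2} Γ(s - 1/2)/Γ(s + 1) X^s + O_s(Y + X^{1/2})`), again with everything proved:

6. the exact factorisation `C - cosh r = (E/2)(1 - eʳ/E)(1 - e⁻ʳ/E)`, `E = e^{arcosh C}`
   (`sub_cosh_eq_factor`), whence `𝒢_σ(C) = ∫_{-R}^{R} e^{-rσ}(C - cosh r)^{1/2} dr =
   √(E/2) E^σ ∫_0^{2R} e^{-ρσ} √(1 - e^{-ρ}) √(1 - e^{ρ-2R}) dρ` (`gHalf_eq`), a truncation of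
   the Beta integral `B_σ = ∫_0^∞ e^{-ρσ} √(1 - e^{-ρ}) dρ = B(σ, 3/2) = Γ(σ)Γ(3/2)/Γ(σ + 3/2)`
   (`betaHalf_eq_Gamma`, via `x = e^{-ρ}` and Mathlib's `Complex.betaIntegral`), with errors
   `≤ e^{-2Rσ}(1/σ + 1/(1 - σ))` (`betaHalf_sub_trunc`, `trunc_sub_betaTrunc`);
7. `F_R(iσ) = Φ_σ(cosh R)` with `Φ_σ(C) = ∫ e^{-rσ}(C - cosh r)_+^{3/2} dr` and
   `Φ_σ' = (3/2) 𝒢_σ` (differentiation under the integral sign, `hasDerivAt_PhiThreeHalves`), so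
   `h(iσ) = (16/(3√2 Y)) (3/2) ∫_{X/2}^{(X+Y)/2} 𝒢_σ(C) dC`;
8. `|𝒢_σ(C) - 2^{-1/2} B_σ (2C)^s| ≤ B_σ + 2(1/σ + 1/(1-σ)) C^{1-s}` (`gHalf_asymp`; `s = σ + 1/2`,
   using `2C - 1/C ≤ E ≤ 2C` and Bernoulli's inequality), and integration over `C` gives
   `h(iσ) = 2 B_σ X^s + O_s(Y + X^{1/2})` (`eq_12_8_real`), where
   `2 B(s - 1/2, 3/2) = π^{1/2} Γ(s - 1/2)/Γ(s + 1)` (`two_mul_betaHalf_eq`).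

The closed form in 4 also reduces the remaining "reader's" estimate (12.9)
(`Iwaniec2002_eq_12_9`, still a named fact) to a uniform asymptotic analysis of the single
special function `F_R(t)` on the real line (a Mehler–Dirichlet-type integral).

Held copy: `book:iwaniec2002-spectral-methods-automorphic-forms`. Mathlib: `Real.arcosh`,
`intervalIntegral.integral_mul_deriv_eq_deriv_mul_of_hasDerivAt`, `integral_rpow`,
`hasDerivAt_integral_of_dominated_loc_of_deriv_le`, `Complex.betaIntegral_eq_Gamma_mul_div`,
`integral_image_eq_integral_abs_deriv_smul`, `rpow_one_add_le_one_add_mul_self`; no Abel integral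
transform or Mehler/conical functions in Mathlib or Literature (`lean search 'Mehler|Abel transform'`:
only the unrelated Abel *summation* transform of `LFunctions/LittlewoodCriterion.lean`).
-/

noncomputable section

namespace Literature.NumberTheory.Automorphic

open MeasureTheory Set Filter Real intervalIntegral
open scoped Topology

namespace SelbergDecay


/-! ## The profile `f_R(r) = (cosh R - cosh r)_+^{3/2}` and its derivatives -/

/-- `f_R(r) = (cosh R - cosh r)_+^{3/2}` (as `√(cosh R - cosh r)³`, which vanishes for `|r| ≥ R`).
[folklore] -/
def coshKernel (R r : ℝ) : ℝ := Real.sqrt (cosh R - cosh r) ^ 3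

/-- `f_R'(r) = -(3/2) (cosh R - cosh r)_+^{1/2} sinh r`. [folklore] -/
def coshKernelDeriv (R r : ℝ) : ℝ := -(3 / 2) * Real.sqrt (cosh R - cosh r) * sinh r

/-- `f_R''(r) = (3/4) sinh² r (cosh R - cosh r)^{-1/2} - (3/2)(cosh R - cosh r)^{1/2} cosh r`
on `|r| < R`. [folklore] -/
def coshKernelDeriv2 (R r : ℝ) : ℝ :=
  3 / 4 * sinh r ^ 2 / Real.sqrt (cosh R - cosh r) - 3 / 2 * Real.sqrt (cosh R - cosh r) * cosh r

variable {R r : ℝ}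

/-- `cosh r < cosh R` for `|r| < R`. [folklore] -/
theorem cosh_sub_cosh_pos (h : |r| < R) : 0 < cosh R - cosh r := by
  have hR : |R| = R := abs_of_pos (lt_of_le_of_lt (abs_nonneg r) h)
  have := Real.cosh_lt_cosh.mpr (show |r| < |R| by rwa [hR])
  linarith

/-- `cosh R ≤ cosh r` for `0 ≤ R ≤ |r|`. [folklore] -/
theorem cosh_sub_cosh_nonpos (hR : 0 ≤ R) (h : R ≤ |r|) : cosh R - cosh r ≤ 0 := by
  have : cosh R ≤ cosh r := by
    rw [← Real.cosh_abs r]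
    exact Real.cosh_le_cosh.mpr (by rw [abs_abs, abs_of_nonneg hR]; exact h)
  linarith

/-- `√(cosh R - cosh r) = 0` off `(-R, R)`. [folklore] -/
theorem sqrt_cosh_sub_cosh_eq_zero (hR : 0 ≤ R) (h : R ≤ |r|) : Real.sqrt (cosh R - cosh r) = 0 :=
  Real.sqrt_eq_zero'.mpr (cosh_sub_cosh_nonpos hR h)

/-- `f_R` vanishes off `(-R, R)`. [folklore] -/
theorem coshKernel_eq_zero (hR : 0 ≤ R) (h : R ≤ |r|) : coshKernel R r = 0 := by
  simp [coshKernel, sqrt_cosh_sub_cosh_eq_zero hR h]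

/-- `f_R'` vanishes off `(-R, R)`. [folklore] -/
theorem coshKernelDeriv_eq_zero (hR : 0 ≤ R) (h : R ≤ |r|) : coshKernelDeriv R r = 0 := by
  simp [coshKernelDeriv, sqrt_cosh_sub_cosh_eq_zero hR h]

/-- `f_R ≥ 0`. [folklore] -/
theorem coshKernel_nonneg (R r : ℝ) : 0 ≤ coshKernel R r := by
  unfold coshKernel; positivity

/-- `f_R` is even. [folklore] -/
theorem coshKernel_neg (R r : ℝ) : coshKernel R (-r) = coshKernel R r := by
  simp [coshKernel]

/-- `f_R''` is even. [folklore] -/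
theorem coshKernelDeriv2_neg (R r : ℝ) : coshKernelDeriv2 R (-r) = coshKernelDeriv2 R r := by
  simp [coshKernelDeriv2]

/-- `f_R` is continuous. [folklore] -/
theorem continuous_coshKernel (R : ℝ) : Continuous (coshKernel R) := by
  unfold coshKernel; fun_prop

/-- `f_R'` is continuous. [folklore] -/
theorem continuous_coshKernelDeriv (R : ℝ) : Continuous (coshKernelDeriv R) := by
  unfold coshKernelDeriv; fun_prop

/-- `f_R''` is measurable. [folklore] -/
theorem measurable_coshKernelDeriv2 (R : ℝ) : Measurable (coshKernelDeriv2 R) := by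
  unfold coshKernelDeriv2; fun_prop

/-- `f_R''` is continuous on `(-R, R)`. [folklore] -/
theorem continuousOn_coshKernelDeriv2 (R : ℝ) : ContinuousOn (coshKernelDeriv2 R) (Ioo (-R) R) := by
  intro r hr
  have h : 0 < cosh R - cosh r := cosh_sub_cosh_pos (abs_lt.mpr hr)
  have hs : Real.sqrt (cosh R - cosh r) ≠ 0 := (Real.sqrt_pos.mpr h).ne'
  unfold coshKernelDeriv2
  apply ContinuousAt.continuousWithinAt
  fun_prop (disch := exact hs)

/-- `|f_R| ≤ cosh R ^ (3/2)`-type crude bound: `f_R(r) ≤ √(cosh R)³`. [folklore] -/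
theorem coshKernel_le (R r : ℝ) : coshKernel R r ≤ Real.sqrt (cosh R) ^ 3 := by
  unfold coshKernel
  gcongr
  linarith [Real.cosh_pos r]

/-- `(f_R)' = f_R'` on `(-R, R)`. [folklore] -/
theorem hasDerivAt_coshKernel (h : |r| < R) : HasDerivAt (coshKernel R) (coshKernelDeriv R r) r := by
  have hD : 0 < cosh R - cosh r := cosh_sub_cosh_pos h
  have h1 : HasDerivAt (fun r => cosh R - cosh r) (-sinh r) r := by
    simpa using (Real.hasDerivAt_cosh r).const_sub (cosh R)
  have h2 : HasDerivAt (fun r => Real.sqrt (cosh R - cosh r)) (-sinh r / (2 * Real.sqrt (cosh R - cosh r))) r :=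
    h1.sqrt hD.ne'
  have h3 := h2.pow 3
  have hs : Real.sqrt (cosh R - cosh r) ≠ 0 := (Real.sqrt_pos.mpr hD).ne'
  refine h3.congr_deriv ?_
  unfold coshKernelDeriv
  field_simp
  ring

/-- `(f_R')' = f_R''` on `(-R, R)`. [folklore] -/
theorem hasDerivAt_coshKernelDeriv (h : |r| < R) :
    HasDerivAt (coshKernelDeriv R) (coshKernelDeriv2 R r) r := by
  have hD : 0 < cosh R - cosh r := cosh_sub_cosh_pos h
  have h1 : HasDerivAt (fun r => cosh R - cosh r) (-sinh r) r := by
    simpa using (Real.hasDerivAt_cosh r).const_sub (cosh R)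
  have h2 : HasDerivAt (fun r => Real.sqrt (cosh R - cosh r)) (-sinh r / (2 * Real.sqrt (cosh R - cosh r))) r :=
    h1.sqrt hD.ne'
  have h3 := ((h2.const_mul (-(3 / 2 : ℝ))).mul (Real.hasDerivAt_sinh r))
  have hs : Real.sqrt (cosh R - cosh r) ≠ 0 := (Real.sqrt_pos.mpr hD).ne'
  refine h3.congr_deriv ?_
  unfold coshKernelDeriv2
  field_simp
  ring

/-- `cosh(p + q) - cosh(p - q) = 2 sinh p sinh q`. [folklore] -/
theorem cosh_add_sub_cosh_sub (p q : ℝ) : cosh (p + q) - cosh (p - q) = 2 * sinh p * sinh q := by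
  rw [Real.cosh_add, Real.cosh_sub]; ring

/-- The one-sided linear lower bound at the endpoint: for `0 ≤ r ≤ R`,
`sinh(R/2) (R - r) ≤ cosh R - cosh r`. [folklore] -/
theorem sinh_half_mul_le_cosh_sub_cosh (hr0 : 0 ≤ r) (hrR : r ≤ R) :
    sinh (R / 2) * (R - r) ≤ cosh R - cosh r := by
  have e : cosh R - cosh r = 2 * sinh ((R + r) / 2) * sinh ((R - r) / 2) := by
    rw [← cosh_add_sub_cosh_sub]; congr 1 <;> ring_nf
  rw [e]
  have h1 : sinh (R / 2) ≤ sinh ((R + r) / 2) := Real.sinh_le_sinh.mpr (by linarith)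
  have h2 : (R - r) / 2 ≤ sinh ((R - r) / 2) := Real.self_le_sinh_iff.mpr (by linarith)
  have h4 : 0 ≤ sinh ((R + r) / 2) := Real.sinh_nonneg_iff.mpr (by linarith)
  have h3 : 0 ≤ (R - r) / 2 := by linarith
  calc sinh (R / 2) * (R - r) = 2 * sinh (R / 2) * ((R - r) / 2) := by ring
    _ ≤ 2 * sinh ((R + r) / 2) * ((R - r) / 2) :=
        mul_le_mul_of_nonneg_right (mul_le_mul_of_nonneg_left h1 (by norm_num)) h3
    _ ≤ 2 * sinh ((R + r) / 2) * sinh ((R - r) / 2) :=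
        mul_le_mul_of_nonneg_left h2 (mul_nonneg (by norm_num) h4)

/-- Two-sided version: for `|r| ≤ R`, `sinh(R/2)(R - |r|) ≤ cosh R - cosh r`. [folklore] -/
theorem sinh_half_mul_le_cosh_sub_cosh' (h : |r| ≤ R) :
    sinh (R / 2) * (R - |r|) ≤ cosh R - cosh r := by
  rw [← Real.cosh_abs r]
  exact sinh_half_mul_le_cosh_sub_cosh (abs_nonneg r) h

/-- The inverse square root of `cosh R - cosh r` against `(R - r)^{-1/2} + (R + r)^{-1/2}`.
[folklore] -/
theorem inv_sqrt_cosh_sub_cosh_le (hR : 0 < R) (h : |r| < R) :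
    1 / Real.sqrt (cosh R - cosh r) ≤
      (Real.sqrt (sinh (R / 2)))⁻¹ * ((R - r) ^ (-(1 / 2 : ℝ)) + (R + r) ^ (-(1 / 2 : ℝ))) := by
  have hs : 0 < sinh (R / 2) := Real.sinh_pos_iff.mpr (by linarith)
  have hlow := sinh_half_mul_le_cosh_sub_cosh' h.le
  have hpos : 0 < sinh (R / 2) * (R - |r|) := mul_pos hs (by linarith)
  have h1 : 1 / Real.sqrt (cosh R - cosh r) ≤ 1 / Real.sqrt (sinh (R / 2) * (R - |r|)) := by
    apply one_div_le_one_div_of_le (Real.sqrt_pos.mpr hpos)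
    exact Real.sqrt_le_sqrt hlow
  refine h1.trans ?_
  rw [Real.sqrt_mul hs.le, one_div, mul_inv]
  refine mul_le_mul_of_nonneg_left ?_ (inv_nonneg.mpr (Real.sqrt_nonneg _))
  have hab : R - |r| = R - r ∨ R - |r| = R + r := by
    rcases le_or_gt 0 r with hr | hr
    · left; rw [abs_of_nonneg hr]
    · right; rw [abs_of_neg hr]; ring
  have e1 : (Real.sqrt (R - |r|))⁻¹ = (R - |r|) ^ (-(1 / 2 : ℝ)) := by
    rw [Real.sqrt_eq_rpow, ← Real.rpow_neg (by linarith)]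
  rw [e1]
  have hp1 : 0 ≤ (R - r) ^ (-(1 / 2 : ℝ)) := Real.rpow_nonneg (by linarith [le_abs_self r]) _
  have hp2 : 0 ≤ (R + r) ^ (-(1 / 2 : ℝ)) := Real.rpow_nonneg (by linarith [neg_abs_le r]) _
  rcases hab with e | e <;> rw [e] <;> linarith

/-! ## Integrability of `f_R''` on `[-R, R]` -/

/-- `(R - r)^{-1/2} + (R + r)^{-1/2}` is integrable on `[-R, R]`. [folklore] -/
theorem intervalIntegrable_endpoints (R : ℝ) :
    IntervalIntegrable (fun r : ℝ => (R - r) ^ (-(1 / 2 : ℝ)) + (R + r) ^ (-(1 / 2 : ℝ))) volume (-R) R := by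
  have h0 : IntervalIntegrable (fun x : ℝ => x ^ (-(1 / 2 : ℝ))) volume (2 * R) 0 :=
    intervalIntegral.intervalIntegrable_rpow' (by norm_num)
  have h0' : IntervalIntegrable (fun x : ℝ => x ^ (-(1 / 2 : ℝ))) volume 0 (2 * R) :=
    intervalIntegral.intervalIntegrable_rpow' (by norm_num)
  have h1 := h0.comp_sub_left R
  have h2 := h0'.comp_add_left R
  have e1 : R - 2 * R = -R := by ring
  have e2 : R - 0 = R := by ring
  have e3 : 0 - R = -R := by ring
  have e4 : 2 * R - R = R := by ring
  rw [e1, e2] at h1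
  rw [e3, e4] at h2
  exact h1.add h2

/-- Pointwise bound for `f_R''` on `(-R, R)`. [folklore] -/
theorem abs_coshKernelDeriv2_le (hR : 0 < R) (h : |r| < R) :
    |coshKernelDeriv2 R r| ≤
      3 / 4 * sinh R ^ 2 * (Real.sqrt (sinh (R / 2)))⁻¹ *
          ((R - r) ^ (-(1 / 2 : ℝ)) + (R + r) ^ (-(1 / 2 : ℝ))) +
        3 / 2 * Real.sqrt (cosh R) * cosh R := by
  have hD : 0 < cosh R - cosh r := cosh_sub_cosh_pos h
  have hsD : 0 < Real.sqrt (cosh R - cosh r) := Real.sqrt_pos.mpr hD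
  have hsinh : sinh r ^ 2 ≤ sinh R ^ 2 := by
    have habs : |sinh r| = sinh |r| := by
      rcases le_or_gt 0 r with hr | hr
      · rw [abs_of_nonneg hr, abs_of_nonneg (Real.sinh_nonneg_iff.mpr hr)]
      · rw [abs_of_neg hr, abs_of_neg (Real.sinh_neg_iff.mpr hr), Real.sinh_neg]
    rw [← sq_abs (sinh r), habs]
    have h1 : sinh |r| ≤ sinh R := Real.sinh_le_sinh.mpr h.le
    have h0 : 0 ≤ sinh |r| := Real.sinh_nonneg_iff.mpr (abs_nonneg r)
    exact pow_le_pow_left₀ h0 h1 2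
  have hcosh : cosh r ≤ cosh R := by
    rw [← Real.cosh_abs r, ← Real.cosh_abs R, abs_of_pos hR]
    exact Real.cosh_le_cosh.mpr (by rw [abs_abs, abs_of_pos hR]; exact h.le)
  have hsq : Real.sqrt (cosh R - cosh r) ≤ Real.sqrt (cosh R) :=
    Real.sqrt_le_sqrt (by linarith [Real.cosh_pos r])
  have hinv := inv_sqrt_cosh_sub_cosh_le hR h
  unfold coshKernelDeriv2
  have hA : |3 / 4 * sinh r ^ 2 / Real.sqrt (cosh R - cosh r)| ≤
      3 / 4 * sinh R ^ 2 * (Real.sqrt (sinh (R / 2)))⁻¹ *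
        ((R - r) ^ (-(1 / 2 : ℝ)) + (R + r) ^ (-(1 / 2 : ℝ))) := by
    rw [abs_of_nonneg (by positivity), div_eq_mul_one_div]
    have h34 : 0 ≤ 3 / 4 * sinh R ^ 2 := by positivity
    calc 3 / 4 * sinh r ^ 2 * (1 / Real.sqrt (cosh R - cosh r))
        ≤ 3 / 4 * sinh R ^ 2 * (1 / Real.sqrt (cosh R - cosh r)) := by
          gcongr
      _ ≤ 3 / 4 * sinh R ^ 2 * ((Real.sqrt (sinh (R / 2)))⁻¹ *
          ((R - r) ^ (-(1 / 2 : ℝ)) + (R + r) ^ (-(1 / 2 : ℝ)))) :=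
          mul_le_mul_of_nonneg_left hinv h34
      _ = _ := by ring
  have hB : |3 / 2 * Real.sqrt (cosh R - cosh r) * cosh r| ≤ 3 / 2 * Real.sqrt (cosh R) * cosh R := by
    rw [abs_of_nonneg (by positivity)]
    gcongr
  calc |3 / 4 * sinh r ^ 2 / Real.sqrt (cosh R - cosh r) - 3 / 2 * Real.sqrt (cosh R - cosh r) * cosh r|
      ≤ |3 / 4 * sinh r ^ 2 / Real.sqrt (cosh R - cosh r)| + |3 / 2 * Real.sqrt (cosh R - cosh r) * cosh r| :=
        abs_sub _ _
    _ ≤ _ := add_le_add hA hB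

/-- `f_R''` is integrable on `[-R, R]`. [folklore] -/
theorem intervalIntegrable_coshKernelDeriv2 (hR : 0 < R) :
    IntervalIntegrable (coshKernelDeriv2 R) volume (-R) R := by
  set A : ℝ := 3 / 4 * sinh R ^ 2 * (Real.sqrt (sinh (R / 2)))⁻¹ with hA
  set B : ℝ := 3 / 2 * Real.sqrt (cosh R) * cosh R with hB
  have hg : IntervalIntegrable (fun r : ℝ => A * ((R - r) ^ (-(1 / 2 : ℝ)) + (R + r) ^ (-(1 / 2 : ℝ))) + B)
      volume (-R) R :=
    ((intervalIntegrable_endpoints R).const_mul A).add intervalIntegrable_const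
  refine hg.mono_fun' (measurable_coshKernelDeriv2 R).aestronglyMeasurable ?_
  rw [EventuallyLE, ae_restrict_iff' measurableSet_uIoc]
  refine ae_of_all _ (fun r hr => ?_)
  rw [uIoc_of_le (by linarith : -R ≤ R)] at hr
  rcases hr.2.lt_or_eq with hlt | heq
  · have habs : |r| < R := abs_lt.mpr ⟨hr.1, hlt⟩
    have := abs_coshKernelDeriv2_le hR habs
    rw [Real.norm_eq_abs, hA, hB]
    linarith
  · -- the endpoint `r = R`: `f''(R)` is the junk value `0`
    subst heq
    have h0 : coshKernelDeriv2 r r = 0 := by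
      simp [coshKernelDeriv2]
    rw [h0, norm_zero]
    have h1 : 0 ≤ (r - r) ^ (-(1 / 2 : ℝ)) := Real.rpow_nonneg (by linarith) _
    have h2 : 0 ≤ (r + r) ^ (-(1 / 2 : ℝ)) := Real.rpow_nonneg (by linarith) _
    have hA0 : 0 ≤ A := by rw [hA]; positivity
    have hB0 : 0 ≤ B := by rw [hB]; positivity
    positivity

/-! ## Integration by parts against `e^{irt}` -/

/-- `d/dr e^{irt} = it e^{irt}`. [folklore] -/
theorem hasDerivAt_cexp_mul (t : ℂ) (r : ℝ) :
    HasDerivAt (fun r : ℝ => Complex.exp (Complex.I * r * t))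
      (Complex.I * t * Complex.exp (Complex.I * r * t)) r := by
  have h1 : HasDerivAt (fun r : ℝ => Complex.I * (r : ℂ) * t) (Complex.I * 1 * t) r :=
    ((hasDerivAt_id r).ofReal_comp.const_mul Complex.I).mul_const t
  have h2 := h1.cexp
  refine h2.congr_deriv ?_
  ring

/-- `r ↦ e^{irt}` is continuous. [folklore] -/
theorem continuous_cexp_mul (t : ℂ) : Continuous (fun r : ℝ => Complex.exp (Complex.I * r * t)) := by
  fun_prop

/-- `‖e^{irt}‖ = e^{-r Im t} ≤ e^{M |Im t|}` for `|r| ≤ M`. [folklore] -/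
theorem norm_cexp_mul_le {t : ℂ} {r M : ℝ} (hr : |r| ≤ M) :
    ‖Complex.exp (Complex.I * r * t)‖ ≤ Real.exp (M * |t.im|) := by
  rw [Complex.norm_exp]
  apply Real.exp_le_exp.mpr
  have e : (Complex.I * r * t).re = -(r * t.im) := by
    simp [Complex.mul_re, Complex.mul_im]
  rw [e]
  calc -(r * t.im) ≤ |r * t.im| := neg_le_abs _
    _ = |r| * |t.im| := abs_mul _ _
    _ ≤ M * |t.im| := mul_le_mul_of_nonneg_right hr (abs_nonneg _)

/-- **Integration by parts against `e^{irt}`**: for `v` continuous on `[a, b]`, differentiable on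
`(a, b)` with integrable derivative `v'`,
`it ∫_a^b e^{irt} v = e^{ibt} v(b) - e^{iat} v(a) - ∫_a^b e^{irt} v'`. [folklore] -/
theorem integral_cexp_mul_eq {a b : ℝ} (hab : a ≤ b) (t : ℂ) {v v' : ℝ → ℂ}
    (hv : ContinuousOn v (Icc a b)) (hvv' : ∀ x ∈ Ioo a b, HasDerivAt v (v' x) x)
    (hv' : IntervalIntegrable v' volume a b) :
    Complex.I * t * ∫ r in a..b, Complex.exp (Complex.I * r * t) * v r =
      Complex.exp (Complex.I * b * t) * v b - Complex.exp (Complex.I * a * t) * v a -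
        ∫ r in a..b, Complex.exp (Complex.I * r * t) * v' r := by
  have hu : ContinuousOn (fun r : ℝ => Complex.exp (Complex.I * r * t)) (uIcc a b) :=
    (continuous_cexp_mul t).continuousOn
  have hv2 : ContinuousOn v (uIcc a b) := by rwa [uIcc_of_le hab]
  have huu' : ∀ x ∈ Ioo (min a b) (max a b),
      HasDerivAt (fun r : ℝ => Complex.exp (Complex.I * r * t))
        (Complex.I * t * Complex.exp (Complex.I * x * t)) x := fun x _ => hasDerivAt_cexp_mul t x
  have hvv2 : ∀ x ∈ Ioo (min a b) (max a b), HasDerivAt v (v' x) x := by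
    rw [min_eq_left hab, max_eq_right hab]; exact hvv'
  have hu' : IntervalIntegrable (fun x : ℝ => Complex.I * t * Complex.exp (Complex.I * x * t)) volume a b :=
    ((continuous_cexp_mul t).const_mul _).intervalIntegrable _ _
  have key := intervalIntegral.integral_mul_deriv_eq_deriv_mul_of_hasDerivAt hu hv2 huu' hvv2 hu' hv'
  rw [key]
  have e : ∫ x in a..b, Complex.I * t * Complex.exp (Complex.I * x * t) * v x =
      Complex.I * t * ∫ x in a..b, Complex.exp (Complex.I * x * t) * v x := by
    rw [← intervalIntegral.integral_const_mul]
    congr 1 with x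
    ring
  rw [e]
  ring

/-- Norm of an oscillatory integral over `[a, b] ⊆ [-M, M]`. [folklore] -/
theorem norm_integral_cexp_mul_le {a b M : ℝ} (hab : a ≤ b) (hM : ∀ r ∈ Icc a b, |r| ≤ M) (t : ℂ)
    {w : ℝ → ℂ} (hw : IntervalIntegrable w volume a b) :
    ‖∫ r in a..b, Complex.exp (Complex.I * r * t) * w r‖ ≤
      Real.exp (M * |t.im|) * ∫ r in a..b, ‖w r‖ := by
  calc ‖∫ r in a..b, Complex.exp (Complex.I * r * t) * w r‖
      ≤ ∫ r in a..b, ‖Complex.exp (Complex.I * r * t) * w r‖ :=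
        intervalIntegral.norm_integral_le_integral_norm hab
    _ ≤ ∫ r in a..b, Real.exp (M * |t.im|) * ‖w r‖ := by
        apply intervalIntegral.integral_mono_on hab
        · exact (hw.continuousOn_mul (continuous_cexp_mul t).continuousOn).norm
        · exact (hw.norm.const_mul _)
        · intro r hr
          rw [norm_mul]
          exact mul_le_mul_of_nonneg_right (norm_cexp_mul_le (hM r hr)) (norm_nonneg _)
    _ = Real.exp (M * |t.im|) * ∫ r in a..b, ‖w r‖ := intervalIntegral.integral_const_mul _ _

/-! ## The pieces `φ_R = sinh² / (cosh R - cosh)^{1/2}` and `χ_R = (cosh R - cosh)^{1/2} cosh` of `f_R''` -/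

/-- `φ_R(r) = sinh² r / √(cosh R - cosh r)`. [folklore] -/
def phiK (R r : ℝ) : ℝ := sinh r ^ 2 / Real.sqrt (cosh R - cosh r)

/-- `φ_R'(r) = 2 sinh r cosh r / √D + sinh³ r / (2 √D³)`, `D = cosh R - cosh r`. [folklore] -/
def phiKDeriv (R r : ℝ) : ℝ :=
  2 * sinh r * cosh r / Real.sqrt (cosh R - cosh r) +
    sinh r ^ 3 / (2 * Real.sqrt (cosh R - cosh r) ^ 3)

/-- `χ_R(r) = √(cosh R - cosh r) cosh r`. [folklore] -/
def chiK (R r : ℝ) : ℝ := Real.sqrt (cosh R - cosh r) * cosh r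

/-- `χ_R'(r) = -sinh r cosh r / (2 √D) + √D sinh r`. [folklore] -/
def chiKDeriv (R r : ℝ) : ℝ :=
  -(sinh r * cosh r) / (2 * Real.sqrt (cosh R - cosh r)) + Real.sqrt (cosh R - cosh r) * sinh r

/-- `f_R'' = (3/4) φ_R - (3/2) χ_R`. [folklore] -/
theorem coshKernelDeriv2_eq (R r : ℝ) :
    coshKernelDeriv2 R r = 3 / 4 * phiK R r - 3 / 2 * chiK R r := by
  unfold coshKernelDeriv2 phiK chiK; ring

/-- `φ_R` is even. [folklore] -/
theorem phiK_neg (R r : ℝ) : phiK R (-r) = phiK R r := by simp [phiK]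

/-- `φ_R(0) = 0`. [folklore] -/
theorem phiK_zero (R : ℝ) : phiK R 0 = 0 := by simp [phiK]

/-- `φ_R ≥ 0`. [folklore] -/
theorem phiK_nonneg (R r : ℝ) : 0 ≤ phiK R r := by unfold phiK; positivity

/-- `φ_R(R) = 0` (junk value of the division by `√0`; the point is irrelevant for integrals). [folklore] -/
theorem phiK_self (R : ℝ) : phiK R R = 0 := by simp [phiK]

/-- `χ_R` vanishes off `(-R, R)`. [folklore] -/
theorem chiK_eq_zero (hR : 0 ≤ R) (h : R ≤ |r|) : chiK R r = 0 := by
  simp [chiK, sqrt_cosh_sub_cosh_eq_zero hR h]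

/-- `χ_R'(R) = 0` (junk value at the endpoint). [folklore] -/
theorem chiKDeriv_self (R : ℝ) : chiKDeriv R R = 0 := by simp [chiKDeriv]

/-- `χ_R` is continuous. [folklore] -/
theorem continuous_chiK (R : ℝ) : Continuous (chiK R) := by unfold chiK; fun_prop

/-- `φ_R` is measurable. [folklore] -/
theorem measurable_phiK (R : ℝ) : Measurable (phiK R) := by unfold phiK; fun_prop

/-- `χ_R'` is measurable. [folklore] -/
theorem measurable_chiKDeriv (R : ℝ) : Measurable (chiKDeriv R) := by unfold chiKDeriv; fun_prop

/-- `(φ_R)' = φ_R'` on `(-R, R)`. [folklore] -/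
theorem hasDerivAt_phiK (h : |r| < R) : HasDerivAt (phiK R) (phiKDeriv R r) r := by
  have hD : 0 < cosh R - cosh r := cosh_sub_cosh_pos h
  have h1 : HasDerivAt (fun r => cosh R - cosh r) (-sinh r) r := by
    simpa using (Real.hasDerivAt_cosh r).const_sub (cosh R)
  have h2 : HasDerivAt (fun r => Real.sqrt (cosh R - cosh r)) (-sinh r / (2 * Real.sqrt (cosh R - cosh r))) r :=
    h1.sqrt hD.ne'
  have hs : Real.sqrt (cosh R - cosh r) ≠ 0 := (Real.sqrt_pos.mpr hD).ne'
  have h3 := ((Real.hasDerivAt_sinh r).pow 2).div h2 hs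
  refine h3.congr_deriv ?_
  unfold phiKDeriv
  simp only [Pi.pow_apply]
  field_simp
  ring

/-- `(χ_R)' = χ_R'` on `(-R, R)`. [folklore] -/
theorem hasDerivAt_chiK (h : |r| < R) : HasDerivAt (chiK R) (chiKDeriv R r) r := by
  have hD : 0 < cosh R - cosh r := cosh_sub_cosh_pos h
  have h1 : HasDerivAt (fun r => cosh R - cosh r) (-sinh r) r := by
    simpa using (Real.hasDerivAt_cosh r).const_sub (cosh R)
  have h2 : HasDerivAt (fun r => Real.sqrt (cosh R - cosh r)) (-sinh r / (2 * Real.sqrt (cosh R - cosh r))) r :=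
    h1.sqrt hD.ne'
  have hs : Real.sqrt (cosh R - cosh r) ≠ 0 := (Real.sqrt_pos.mpr hD).ne'
  have h3 := h2.mul (Real.hasDerivAt_cosh r)
  refine h3.congr_deriv ?_
  unfold chiKDeriv
  ring

/-- `φ_R` is continuous on `(-R, R)`. [folklore] -/
theorem continuousOn_phiK (R : ℝ) : ContinuousOn (phiK R) (Ioo (-R) R) := fun _ hr =>
  (hasDerivAt_phiK (abs_lt.mpr hr)).continuousAt.continuousWithinAt

/-- `φ_R'` is continuous on `(-R, R)`. [folklore] -/
theorem continuousOn_phiKDeriv (R : ℝ) : ContinuousOn (phiKDeriv R) (Ioo (-R) R) := by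
  intro r hr
  have h : 0 < cosh R - cosh r := cosh_sub_cosh_pos (abs_lt.mpr hr)
  have hs : Real.sqrt (cosh R - cosh r) ≠ 0 := (Real.sqrt_pos.mpr h).ne'
  have hs3 : 2 * Real.sqrt (cosh R - cosh r) ^ 3 ≠ 0 := by positivity
  unfold phiKDeriv
  apply ContinuousAt.continuousWithinAt
  fun_prop (disch := assumption)

/-- On `[0, R)` the derivative `φ_R'` is non-negative (`φ_R` increases to `+∞`). [folklore] -/
theorem phiKDeriv_nonneg (hr : 0 ≤ r) : 0 ≤ phiKDeriv R r := by
  unfold phiKDeriv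
  have h1 : 0 ≤ sinh r := Real.sinh_nonneg_iff.mpr hr
  have h2 : 0 < cosh r := Real.cosh_pos r
  positivity

/-- A general integrability criterion on `[-R, R]`: measurable `w` with
`|w| ≤ A / √(cosh R - cosh r) + B` inside and `w(R) = 0`. [folklore] -/
theorem intervalIntegrable_of_le_inv_sqrt (hR : 0 < R) {w : ℝ → ℝ} (hw : Measurable w) {A B : ℝ}
    (hA : 0 ≤ A) (hB : 0 ≤ B)
    (h : ∀ r, |r| < R → |w r| ≤ A * (1 / Real.sqrt (cosh R - cosh r)) + B) (hwR : w R = 0) :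
    IntervalIntegrable w volume (-R) R := by
  set c : ℝ := (Real.sqrt (sinh (R / 2)))⁻¹ with hc
  have hc0 : 0 ≤ c := by rw [hc]; positivity
  have hg : IntervalIntegrable
      (fun r : ℝ => A * c * ((R - r) ^ (-(1 / 2 : ℝ)) + (R + r) ^ (-(1 / 2 : ℝ))) + B) volume (-R) R :=
    ((intervalIntegrable_endpoints R).const_mul (A * c)).add intervalIntegrable_const
  refine hg.mono_fun' hw.aestronglyMeasurable ?_
  rw [EventuallyLE, ae_restrict_iff' measurableSet_uIoc]
  refine ae_of_all _ (fun r hr => ?_)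
  rw [uIoc_of_le (by linarith : -R ≤ R)] at hr
  have h1 : 0 ≤ (R - r) ^ (-(1 / 2 : ℝ)) := Real.rpow_nonneg (by linarith [hr.2]) _
  have h2 : 0 ≤ (R + r) ^ (-(1 / 2 : ℝ)) := Real.rpow_nonneg (by linarith [hr.1]) _
  rcases hr.2.lt_or_eq with hlt | heq
  · have habs : |r| < R := abs_lt.mpr ⟨hr.1, hlt⟩
    have hb := h r habs
    have hinv := inv_sqrt_cosh_sub_cosh_le hR habs
    rw [Real.norm_eq_abs]
    calc |w r| ≤ A * (1 / Real.sqrt (cosh R - cosh r)) + B := hb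
      _ ≤ A * (c * ((R - r) ^ (-(1 / 2 : ℝ)) + (R + r) ^ (-(1 / 2 : ℝ)))) + B := by
          rw [hc]; gcongr
      _ = A * c * ((R - r) ^ (-(1 / 2 : ℝ)) + (R + r) ^ (-(1 / 2 : ℝ))) + B := by ring
  · subst heq
    rw [hwR, norm_zero]
    positivity

/-- `|φ_R| ≤ sinh² R / √(cosh R - cosh r)` on `(-R, R)`. [folklore] -/
theorem abs_phiK_le (h : |r| < R) :
    |phiK R r| ≤ sinh R ^ 2 * (1 / Real.sqrt (cosh R - cosh r)) + 0 := by
  have hD : 0 < cosh R - cosh r := cosh_sub_cosh_pos h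
  have hsinh : sinh r ^ 2 ≤ sinh R ^ 2 := by
    have habs : |sinh r| = sinh |r| := by
      rcases le_or_gt 0 r with hr | hr
      · rw [abs_of_nonneg hr, abs_of_nonneg (Real.sinh_nonneg_iff.mpr hr)]
      · rw [abs_of_neg hr, abs_of_neg (Real.sinh_neg_iff.mpr hr), Real.sinh_neg]
    rw [← sq_abs (sinh r), habs]
    have h1 : sinh |r| ≤ sinh R := Real.sinh_le_sinh.mpr h.le
    have h0 : 0 ≤ sinh |r| := Real.sinh_nonneg_iff.mpr (abs_nonneg r)
    exact pow_le_pow_left₀ h0 h1 2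
  rw [abs_of_nonneg (phiK_nonneg R r), add_zero, phiK, div_eq_mul_one_div]
  exact mul_le_mul_of_nonneg_right hsinh (by positivity)

/-- `φ_R` is integrable on `[-R, R]`. [folklore] -/
theorem intervalIntegrable_phiK (hR : 0 < R) : IntervalIntegrable (phiK R) volume (-R) R :=
  intervalIntegrable_of_le_inv_sqrt hR (measurable_phiK R) (by positivity) le_rfl
    (fun _ h => abs_phiK_le h) (phiK_self R)

/-- `|χ_R'| ≤ (sinh R cosh R / 2) / √(cosh R - cosh r) + √(cosh R) sinh R` on `(-R, R)`. [folklore] -/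
theorem abs_chiKDeriv_le (hR : 0 < R) (h : |r| < R) :
    |chiKDeriv R r| ≤ sinh R * cosh R / 2 * (1 / Real.sqrt (cosh R - cosh r)) +
      Real.sqrt (cosh R) * sinh R := by
  have hD : 0 < cosh R - cosh r := cosh_sub_cosh_pos h
  have habs_sinh : |sinh r| ≤ sinh R := by
    have habs : |sinh r| = sinh |r| := by
      rcases le_or_gt 0 r with hr | hr
      · rw [abs_of_nonneg hr, abs_of_nonneg (Real.sinh_nonneg_iff.mpr hr)]
      · rw [abs_of_neg hr, abs_of_neg (Real.sinh_neg_iff.mpr hr), Real.sinh_neg]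
    rw [habs]; exact Real.sinh_le_sinh.mpr h.le
  have hcosh : cosh r ≤ cosh R := by
    rw [← Real.cosh_abs r, ← Real.cosh_abs R, abs_of_pos hR]
    exact Real.cosh_le_cosh.mpr (by rw [abs_abs, abs_of_pos hR]; exact h.le)
  have hcosh0 : 0 < cosh r := Real.cosh_pos r
  have hsq : Real.sqrt (cosh R - cosh r) ≤ Real.sqrt (cosh R) :=
    Real.sqrt_le_sqrt (by linarith)
  have hsR : 0 ≤ sinh R := Real.sinh_nonneg_iff.mpr hR.le
  unfold chiKDeriv
  have hA : |-(sinh r * cosh r) / (2 * Real.sqrt (cosh R - cosh r))| ≤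
      sinh R * cosh R / 2 * (1 / Real.sqrt (cosh R - cosh r)) := by
    rw [abs_div, abs_neg, abs_mul, abs_of_pos hcosh0,
      abs_of_pos (by positivity : 0 < 2 * Real.sqrt (cosh R - cosh r))]
    rw [div_le_iff₀ (by positivity)]
    calc |sinh r| * cosh r ≤ sinh R * cosh R := by gcongr
      _ = sinh R * cosh R / 2 * (1 / Real.sqrt (cosh R - cosh r)) * (2 * Real.sqrt (cosh R - cosh r)) := by
          field_simp
  have hB : |Real.sqrt (cosh R - cosh r) * sinh r| ≤ Real.sqrt (cosh R) * sinh R := by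
    rw [abs_mul, abs_of_nonneg (Real.sqrt_nonneg _)]
    gcongr
  exact (abs_add_le _ _).trans (add_le_add hA hB)

/-- `χ_R'` is integrable on `[-R, R]`. [folklore] -/
theorem intervalIntegrable_chiKDeriv (hR : 0 < R) : IntervalIntegrable (chiKDeriv R) volume (-R) R :=
  intervalIntegrable_of_le_inv_sqrt hR (measurable_chiKDeriv R) (by positivity)
    (by positivity) (fun _ h => abs_chiKDeriv_le hR h) (chiKDeriv_self R)

/-! ## The Fourier integral of `f_R` and two integrations by parts -/

/-- `F_R(t) = ∫_{-R}^{R} e^{irt} (cosh R - cosh r)^{3/2} dr`. [folklore] -/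
def coshKernelFourier (R : ℝ) (t : ℂ) : ℂ :=
  ∫ r in (-R)..R, Complex.exp (Complex.I * r * t) * (coshKernel R r : ℂ)

/-- Real interval-integrable functions are interval-integrable as complex-valued functions. [folklore] -/
theorem intervalIntegrable_ofReal {f : ℝ → ℝ} {a b : ℝ} (hf : IntervalIntegrable f volume a b) :
    IntervalIntegrable (fun r => (f r : ℂ)) volume a b := by
  rw [intervalIntegrable_iff] at hf ⊢
  exact hf.ofReal

/-- `(it)² F_R(t) = ∫_{-R}^{R} e^{irt} f_R''(r) dr`. [folklore] -/
theorem sq_mul_coshKernelFourier (hR : 0 < R) (t : ℂ) :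
    (Complex.I * t) ^ 2 * coshKernelFourier R t =
      ∫ r in (-R)..R, Complex.exp (Complex.I * r * t) * (coshKernelDeriv2 R r : ℂ) := by
  have hRR : -R ≤ R := by linarith
  have habsR : R ≤ |R| := le_abs_self R
  have habsR' : R ≤ |(-R)| := by rw [abs_neg]; exact le_abs_self R
  -- first integration by parts
  have step1 := integral_cexp_mul_eq hRR t (v := fun r => (coshKernel R r : ℂ))
    (v' := fun r => (coshKernelDeriv R r : ℂ))
    (Complex.continuous_ofReal.comp (continuous_coshKernel R)).continuousOn
    (fun x hx => (hasDerivAt_coshKernel (abs_lt.mpr hx)).ofReal_comp)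
    (intervalIntegrable_ofReal ((continuous_coshKernelDeriv R).intervalIntegrable _ _))
  rw [coshKernel_eq_zero hR.le habsR, coshKernel_eq_zero hR.le habsR'] at step1
  -- second integration by parts
  have step2 := integral_cexp_mul_eq hRR t (v := fun r => (coshKernelDeriv R r : ℂ))
    (v' := fun r => (coshKernelDeriv2 R r : ℂ))
    (Complex.continuous_ofReal.comp (continuous_coshKernelDeriv R)).continuousOn
    (fun x hx => (hasDerivAt_coshKernelDeriv (abs_lt.mpr hx)).ofReal_comp)
    (intervalIntegrable_ofReal (intervalIntegrable_coshKernelDeriv2 hR))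
  rw [coshKernelDeriv_eq_zero hR.le habsR, coshKernelDeriv_eq_zero hR.le habsR'] at step2
  simp only [Complex.ofReal_zero, mul_zero, sub_zero, zero_sub] at step1 step2
  unfold coshKernelFourier
  rw [pow_two, mul_assoc, step1, mul_neg, step2, neg_neg]

/-! ## The `χ`-part: one more integration by parts -/

/-- The `χ`-part decays like `1/|t|`: `‖∫_{-R}^{R} e^{irt} χ_R‖ ≤ e^{R|Im t|} ‖χ_R'‖₁ / |t|`. [folklore] -/
theorem norm_integral_cexp_chiK_le (hR : 0 < R) {t : ℂ} (ht : t ≠ 0) :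
    ‖∫ r in (-R)..R, Complex.exp (Complex.I * r * t) * (chiK R r : ℂ)‖ ≤
      Real.exp (R * |t.im|) * (∫ r in (-R)..R, |chiKDeriv R r|) / ‖t‖ := by
  have hRR : -R ≤ R := by linarith
  have habsR : R ≤ |R| := le_abs_self R
  have habsR' : R ≤ |(-R)| := by rw [abs_neg]; exact le_abs_self R
  have step := integral_cexp_mul_eq hRR t (v := fun r => (chiK R r : ℂ))
    (v' := fun r => (chiKDeriv R r : ℂ))
    (Complex.continuous_ofReal.comp (continuous_chiK R)).continuousOn
    (fun x hx => (hasDerivAt_chiK (abs_lt.mpr hx)).ofReal_comp)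
    (intervalIntegrable_ofReal (intervalIntegrable_chiKDeriv hR))
  rw [chiK_eq_zero hR.le habsR, chiK_eq_zero hR.le habsR'] at step
  simp only [Complex.ofReal_zero, mul_zero, sub_zero, zero_sub] at step
  have hM : ∀ r ∈ Icc (-R) R, |r| ≤ R := fun r hr => abs_le.mpr hr
  have hbound := norm_integral_cexp_mul_le hRR hM t (intervalIntegrable_ofReal (intervalIntegrable_chiKDeriv hR))
  have ht0 : 0 < ‖t‖ := norm_pos_iff.mpr ht
  rw [le_div_iff₀ ht0]
  have e : ‖∫ r in (-R)..R, Complex.exp (Complex.I * r * t) * (chiK R r : ℂ)‖ * ‖t‖ =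
      ‖Complex.I * t * ∫ r in (-R)..R, Complex.exp (Complex.I * r * t) * (chiK R r : ℂ)‖ := by
    rw [norm_mul, norm_mul, Complex.norm_I, one_mul, mul_comm]
  rw [e, step, norm_neg]
  refine hbound.trans (le_of_eq ?_)
  congr 1
  refine intervalIntegral.integral_congr (fun r _ => ?_)
  simp only [Complex.norm_real, Real.norm_eq_abs]

/-! ## The `φ`-part: the endpoint singularity costs `‖t‖^{-1/2}` -/

/-- `(a⁻¹)^{-1/2} = a^{1/2}`. [folklore] -/
theorem rpow_neg_half_inv_eq {a : ℝ} (ha : 0 < a) : (a⁻¹) ^ (-(1 / 2 : ℝ)) = a ^ (1 / 2 : ℝ) := by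
  rw [Real.inv_rpow ha.le, ← Real.rpow_neg ha.le, neg_neg]

/-- `(a⁻¹)^{1/2} = a^{-1/2}`. [folklore] -/
theorem rpow_half_inv_eq {a : ℝ} (ha : 0 < a) : (a⁻¹) ^ (1 / 2 : ℝ) = a ^ (-(1 / 2 : ℝ)) := by
  rw [Real.inv_rpow ha.le, ← Real.rpow_neg ha.le]

/-- `a^{1/2} a⁻¹ = a^{-1/2}`. [folklore] -/
theorem rpow_half_mul_inv_eq {a : ℝ} (ha : 0 < a) : a ^ (1 / 2 : ℝ) * a⁻¹ = a ^ (-(1 / 2 : ℝ)) := by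
  rw [← Real.rpow_neg_one, ← Real.rpow_add ha]; norm_num

/-- `∫_{R-δ}^{R} (R - r)^{-1/2} dr = 2 δ^{1/2}`. [folklore] -/
theorem integral_endpoint_rpow (δ R : ℝ) :
    ∫ r in (R - δ)..R, (R - r) ^ (-(1 / 2 : ℝ)) = 2 * δ ^ (1 / 2 : ℝ) := by
  rw [intervalIntegral.integral_comp_sub_left (fun x => x ^ (-(1 / 2 : ℝ))) R, sub_self,
    show R - (R - δ) = δ by ring, integral_rpow (Or.inl (by norm_num))]
  rw [show (-(1 / 2 : ℝ)) + 1 = 1 / 2 by norm_num, Real.zero_rpow (by norm_num)]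
  ring

/-- Pointwise bound for `φ_R` near the right endpoint: for `0 ≤ r < R`,
`φ_R(r) ≤ 2 sinh² R (√ sinh(R/2))⁻¹ (R - r)^{-1/2}`. [folklore] -/
theorem phiK_le_endpoint (hR : 0 < R) (hr0 : 0 ≤ r) (hrR : r < R) :
    phiK R r ≤ 2 * (sinh R ^ 2 * (Real.sqrt (sinh (R / 2)))⁻¹) * (R - r) ^ (-(1 / 2 : ℝ)) := by
  have habs : |r| < R := by rw [abs_of_nonneg hr0]; exact hrR
  have h1 := abs_phiK_le habs
  rw [abs_of_nonneg (phiK_nonneg R r), add_zero] at h1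
  have h2 := inv_sqrt_cosh_sub_cosh_le hR habs
  have h3 : (R + r) ^ (-(1 / 2 : ℝ)) ≤ (R - r) ^ (-(1 / 2 : ℝ)) :=
    Real.rpow_le_rpow_of_nonpos (by linarith) (by linarith) (by norm_num)
  have hK : 0 ≤ sinh R ^ 2 := sq_nonneg _
  have hc : 0 ≤ (Real.sqrt (sinh (R / 2)))⁻¹ := by positivity
  calc phiK R r ≤ sinh R ^ 2 * (1 / Real.sqrt (cosh R - cosh r)) := h1
    _ ≤ sinh R ^ 2 * ((Real.sqrt (sinh (R / 2)))⁻¹ * ((R - r) ^ (-(1 / 2 : ℝ)) + (R + r) ^ (-(1 / 2 : ℝ)))) :=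
        mul_le_mul_of_nonneg_left h2 hK
    _ ≤ sinh R ^ 2 * ((Real.sqrt (sinh (R / 2)))⁻¹ * ((R - r) ^ (-(1 / 2 : ℝ)) + (R - r) ^ (-(1 / 2 : ℝ)))) := by
        gcongr
    _ = _ := by ring

/-- **The half-interval estimate**: for `‖t‖ ≥ 1/R`,
`‖∫_0^R e^{irt} φ_R(r) dr‖ ≤ 8 e^{R|Im t|} sinh² R (√sinh(R/2))⁻¹ ‖t‖^{-1/2}`. [folklore] -/
theorem norm_integral_cexp_phiK_half_le (hR : 0 < R) {t : ℂ} (ht : R⁻¹ ≤ ‖t‖) :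
    ‖∫ r in (0 : ℝ)..R, Complex.exp (Complex.I * r * t) * (phiK R r : ℂ)‖ ≤
      8 * Real.exp (R * |t.im|) * (sinh R ^ 2 * (Real.sqrt (sinh (R / 2)))⁻¹) *
        ‖t‖ ^ (-(1 / 2 : ℝ)) := by
  have hnorm : 0 < ‖t‖ := lt_of_lt_of_le (inv_pos.mpr hR) ht
  have ht0 : t ≠ 0 := norm_pos_iff.mp hnorm
  set δ : ℝ := ‖t‖⁻¹ with hδ
  have hδ0 : 0 < δ := inv_pos.mpr hnorm
  have hδR : δ ≤ R := inv_le_of_inv_le₀ hR ht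
  set L : ℝ := R - δ with hL
  have hL0 : 0 ≤ L := by rw [hL]; linarith
  have hLR : L < R := by rw [hL]; linarith
  set K : ℝ := sinh R ^ 2 * (Real.sqrt (sinh (R / 2)))⁻¹ with hK
  have hK0 : 0 ≤ K := by rw [hK]; positivity
  set E : ℝ := Real.exp (R * |t.im|) with hE
  have hE0 : 0 < E := Real.exp_pos _
  -- integrability of `e^{irt} φ` on sub-intervals of `[-R, R]`
  have hφI : IntervalIntegrable (fun r => (phiK R r : ℂ)) volume (-R) R :=
    intervalIntegrable_ofReal (intervalIntegrable_phiK hR)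
  have hsub1 : uIcc 0 L ⊆ uIcc (-R) R := by
    rw [uIcc_of_le hL0, uIcc_of_le (by linarith : -R ≤ R)]
    exact Icc_subset_Icc (by linarith) hLR.le
  have hsub2 : uIcc L R ⊆ uIcc (-R) R := by
    rw [uIcc_of_le hLR.le, uIcc_of_le (by linarith : -R ≤ R)]
    exact Icc_subset_Icc (by linarith) le_rfl
  have hφ1 : IntervalIntegrable (fun r => (phiK R r : ℂ)) volume 0 L := hφI.mono_set hsub1
  have hφ2 : IntervalIntegrable (fun r => (phiK R r : ℂ)) volume L R := hφI.mono_set hsub2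
  have heφ1 : IntervalIntegrable (fun r => Complex.exp (Complex.I * r * t) * (phiK R r : ℂ)) volume 0 L :=
    hφ1.continuousOn_mul (continuous_cexp_mul t).continuousOn
  have heφ2 : IntervalIntegrable (fun r => Complex.exp (Complex.I * r * t) * (phiK R r : ℂ)) volume L R :=
    hφ2.continuousOn_mul (continuous_cexp_mul t).continuousOn
  rw [← intervalIntegral.integral_add_adjacent_intervals heφ1 heφ2]
  -- (i) the main piece `[0, L]` by parts
  have hIcc : Icc 0 L ⊆ Ioo (-R) R := fun x hx => ⟨by linarith [hx.1], lt_of_le_of_lt hx.2 hLR⟩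
  have hcont : ContinuousOn (fun r => (phiK R r : ℂ)) (Icc 0 L) :=
    (Complex.continuous_ofReal.comp_continuousOn ((continuousOn_phiK R).mono hIcc))
  have hderiv : ∀ x ∈ Ioo 0 L, HasDerivAt (fun r => (phiK R r : ℂ)) ((phiKDeriv R x : ℂ)) x := by
    intro x hx
    exact (hasDerivAt_phiK (abs_lt.mpr ⟨by linarith [hx.1], lt_trans hx.2 hLR⟩)).ofReal_comp
  have hφ'cont : ContinuousOn (phiKDeriv R) (Icc 0 L) := (continuousOn_phiKDeriv R).mono hIcc
  have hφ'int : IntervalIntegrable (phiKDeriv R) volume 0 L :=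
    (hφ'cont.mono (by rw [uIcc_of_le hL0])).intervalIntegrable
  have step := integral_cexp_mul_eq hL0 t hcont hderiv (intervalIntegrable_ofReal hφ'int)
  rw [phiK_zero] at step
  simp only [Complex.ofReal_zero, mul_zero, sub_zero] at step
  have hFTC : ∫ r in (0 : ℝ)..L, phiKDeriv R r = phiK R L - phiK R 0 := by
    apply intervalIntegral.integral_eq_sub_of_hasDerivAt
    · intro x hx
      rw [uIcc_of_le hL0] at hx
      exact hasDerivAt_phiK (abs_lt.mpr ⟨by linarith [hx.1], lt_of_le_of_lt hx.2 hLR⟩)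
    · exact hφ'int
  rw [phiK_zero, sub_zero] at hFTC
  have hmain : ‖∫ r in (0 : ℝ)..L, Complex.exp (Complex.I * r * t) * (phiK R r : ℂ)‖ ≤
      2 * E * phiK R L / ‖t‖ := by
    rw [le_div_iff₀ hnorm]
    have e : ‖∫ r in (0 : ℝ)..L, Complex.exp (Complex.I * r * t) * (phiK R r : ℂ)‖ * ‖t‖ =
        ‖Complex.I * t * ∫ r in (0 : ℝ)..L, Complex.exp (Complex.I * r * t) * (phiK R r : ℂ)‖ := by
      rw [norm_mul, norm_mul, Complex.norm_I, one_mul, mul_comm]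
    rw [e, step]
    have hM : ∀ r ∈ Icc 0 L, |r| ≤ R := fun r hr => by
      rw [abs_of_nonneg hr.1]; exact hr.2.trans hLR.le
    have hb1 : ‖Complex.exp (Complex.I * L * t) * (phiK R L : ℂ)‖ ≤ E * phiK R L := by
      rw [norm_mul, Complex.norm_real, Real.norm_of_nonneg (phiK_nonneg R L)]
      exact mul_le_mul_of_nonneg_right (norm_cexp_mul_le (hM L ⟨hL0, le_rfl⟩)) (phiK_nonneg R L)
    have hb2 : ‖∫ r in (0 : ℝ)..L, Complex.exp (Complex.I * r * t) * (phiKDeriv R r : ℂ)‖ ≤ E * phiK R L := by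
      refine (norm_integral_cexp_mul_le hL0 hM t (intervalIntegrable_ofReal hφ'int)).trans ?_
      have e2 : ∫ r in (0 : ℝ)..L, ‖(phiKDeriv R r : ℂ)‖ = ∫ r in (0 : ℝ)..L, phiKDeriv R r := by
        refine intervalIntegral.integral_congr (fun r hr => ?_)
        rw [uIcc_of_le hL0] at hr
        simp only [Complex.norm_real, Real.norm_of_nonneg (phiKDeriv_nonneg (R := R) hr.1)]
      rw [e2, hFTC]
    calc ‖Complex.exp (Complex.I * L * t) * (phiK R L : ℂ) -
          ∫ r in (0 : ℝ)..L, Complex.exp (Complex.I * r * t) * (phiKDeriv R r : ℂ)‖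
        ≤ ‖Complex.exp (Complex.I * L * t) * (phiK R L : ℂ)‖ +
          ‖∫ r in (0 : ℝ)..L, Complex.exp (Complex.I * r * t) * (phiKDeriv R r : ℂ)‖ := norm_sub_le _ _
      _ ≤ E * phiK R L + E * phiK R L := add_le_add hb1 hb2
      _ = 2 * E * phiK R L := by ring
  -- (ii) the tail `[L, R]`
  have htail : ‖∫ r in L..R, Complex.exp (Complex.I * r * t) * (phiK R r : ℂ)‖ ≤
      E * (2 * K * (2 * δ ^ (1 / 2 : ℝ))) := by
    have hM : ∀ r ∈ Icc L R, |r| ≤ R := fun r hr => by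
      rw [abs_of_nonneg (hL0.trans hr.1)]; exact hr.2
    refine (norm_integral_cexp_mul_le hLR.le hM t hφ2).trans ?_
    refine mul_le_mul_of_nonneg_left ?_ hE0.le
    have hrpow : IntervalIntegrable (fun r : ℝ => (R - r) ^ (-(1 / 2 : ℝ))) volume L R := by
      have h0 : IntervalIntegrable (fun x : ℝ => x ^ (-(1 / 2 : ℝ))) volume (R - L) 0 :=
        intervalIntegral.intervalIntegrable_rpow' (by norm_num)
      have h1 := h0.comp_sub_left R
      rwa [show R - (R - L) = L by ring, sub_zero] at h1
    calc ∫ r in L..R, ‖(phiK R r : ℂ)‖ ≤ ∫ r in L..R, 2 * K * (R - r) ^ (-(1 / 2 : ℝ)) := by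
          apply intervalIntegral.integral_mono_on hLR.le hφ2.norm (hrpow.const_mul _)
          intro r hr
          rw [Complex.norm_real, Real.norm_of_nonneg (phiK_nonneg R r)]
          rcases hr.2.lt_or_eq with hlt | heq
          · exact phiK_le_endpoint hR (hL0.trans hr.1) hlt
          · rw [heq, phiK_self, sub_self, Real.zero_rpow (by norm_num)]; simp
      _ = 2 * K * (2 * δ ^ (1 / 2 : ℝ)) := by
          rw [intervalIntegral.integral_const_mul, hL, integral_endpoint_rpow δ R]
  -- (iii) the size of `φ(L)`
  have hphiL : phiK R L ≤ 2 * K * δ ^ (-(1 / 2 : ℝ)) := by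
    have habsL : |L| < R := by rw [abs_of_nonneg hL0]; exact hLR
    have h1 := abs_phiK_le habsL
    rw [abs_of_nonneg (phiK_nonneg R L), add_zero] at h1
    have h2 := inv_sqrt_cosh_sub_cosh_le hR habsL
    have e1 : R - L = δ := by rw [hL]; ring
    have h3 : (R + L) ^ (-(1 / 2 : ℝ)) ≤ δ ^ (-(1 / 2 : ℝ)) :=
      Real.rpow_le_rpow_of_nonpos hδ0 (by rw [hL]; linarith) (by norm_num)
    rw [e1] at h2
    have hKn : 0 ≤ sinh R ^ 2 := sq_nonneg _
    calc phiK R L ≤ sinh R ^ 2 * (1 / Real.sqrt (cosh R - cosh L)) := h1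
      _ ≤ sinh R ^ 2 * ((Real.sqrt (sinh (R / 2)))⁻¹ * (δ ^ (-(1 / 2 : ℝ)) + (R + L) ^ (-(1 / 2 : ℝ)))) :=
          mul_le_mul_of_nonneg_left h2 hKn
      _ ≤ sinh R ^ 2 * ((Real.sqrt (sinh (R / 2)))⁻¹ * (δ ^ (-(1 / 2 : ℝ)) + δ ^ (-(1 / 2 : ℝ)))) := by
          gcongr
      _ = 2 * K * δ ^ (-(1 / 2 : ℝ)) := by rw [hK]; ring
  -- combine
  have hδ1 : δ ^ (-(1 / 2 : ℝ)) / ‖t‖ = ‖t‖ ^ (-(1 / 2 : ℝ)) := by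
    rw [hδ, rpow_neg_half_inv_eq hnorm, div_eq_mul_inv, rpow_half_mul_inv_eq hnorm]
  have hδ2 : δ ^ (1 / 2 : ℝ) = ‖t‖ ^ (-(1 / 2 : ℝ)) := by rw [hδ, rpow_half_inv_eq hnorm]
  calc ‖(∫ r in (0 : ℝ)..L, Complex.exp (Complex.I * r * t) * (phiK R r : ℂ)) +
        ∫ r in L..R, Complex.exp (Complex.I * r * t) * (phiK R r : ℂ)‖
      ≤ ‖∫ r in (0 : ℝ)..L, Complex.exp (Complex.I * r * t) * (phiK R r : ℂ)‖ +
        ‖∫ r in L..R, Complex.exp (Complex.I * r * t) * (phiK R r : ℂ)‖ := norm_add_le _ _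
    _ ≤ 2 * E * phiK R L / ‖t‖ + E * (2 * K * (2 * δ ^ (1 / 2 : ℝ))) := add_le_add hmain htail
    _ ≤ 2 * E * (2 * K * δ ^ (-(1 / 2 : ℝ))) / ‖t‖ + E * (2 * K * (2 * δ ^ (1 / 2 : ℝ))) := by
        gcongr
    _ = 4 * E * K * (δ ^ (-(1 / 2 : ℝ)) / ‖t‖) + 4 * E * K * δ ^ (1 / 2 : ℝ) := by ring
    _ = 8 * E * K * ‖t‖ ^ (-(1 / 2 : ℝ)) := by rw [hδ1, hδ2]; ring
    _ = _ := by rw [hK]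

/-- The `φ`-part over the whole interval `[-R, R]` (by evenness of `φ_R`). [folklore] -/
theorem norm_integral_cexp_phiK_le (hR : 0 < R) {t : ℂ} (ht : R⁻¹ ≤ ‖t‖) :
    ‖∫ r in (-R)..R, Complex.exp (Complex.I * r * t) * (phiK R r : ℂ)‖ ≤
      16 * Real.exp (R * |t.im|) * (sinh R ^ 2 * (Real.sqrt (sinh (R / 2)))⁻¹) *
        ‖t‖ ^ (-(1 / 2 : ℝ)) := by
  have hφI : IntervalIntegrable (fun r => (phiK R r : ℂ)) volume (-R) R :=
    intervalIntegrable_ofReal (intervalIntegrable_phiK hR)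
  have hRR : -R ≤ R := by linarith
  have h1 : IntervalIntegrable (fun r => (phiK R r : ℂ)) volume (-R) 0 :=
    hφI.mono_set (by rw [uIcc_of_le hRR, uIcc_of_le (by linarith : -R ≤ 0)]; exact Icc_subset_Icc le_rfl hR.le)
  have h2 : IntervalIntegrable (fun r => (phiK R r : ℂ)) volume 0 R :=
    hφI.mono_set (by rw [uIcc_of_le hRR, uIcc_of_le hR.le]; exact Icc_subset_Icc (by linarith) le_rfl)
  have he1 : IntervalIntegrable (fun r => Complex.exp (Complex.I * r * t) * (phiK R r : ℂ)) volume (-R) 0 :=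
    h1.continuousOn_mul (continuous_cexp_mul t).continuousOn
  have he2 : IntervalIntegrable (fun r => Complex.exp (Complex.I * r * t) * (phiK R r : ℂ)) volume 0 R :=
    h2.continuousOn_mul (continuous_cexp_mul t).continuousOn
  rw [← intervalIntegral.integral_add_adjacent_intervals he1 he2]
  -- the left half is the right half at `-t`
  have hleft : ∫ r in (-R)..0, Complex.exp (Complex.I * r * t) * (phiK R r : ℂ) =
      ∫ r in (0 : ℝ)..R, Complex.exp (Complex.I * r * (-t)) * (phiK R r : ℂ) := by
    have := intervalIntegral.integral_comp_neg (a := 0) (b := R)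
      (f := fun r : ℝ => Complex.exp (Complex.I * r * t) * (phiK R r : ℂ))
    rw [neg_zero] at this
    rw [← this]
    refine intervalIntegral.integral_congr (fun r _ => ?_)
    simp only [phiK_neg, Complex.ofReal_neg]
    congr 1
    congr 1
    ring
  have ht' : R⁻¹ ≤ ‖-t‖ := by rwa [norm_neg]
  have hb1 := norm_integral_cexp_phiK_half_le hR ht'
  rw [norm_neg, Complex.neg_im, abs_neg] at hb1
  have hb2 := norm_integral_cexp_phiK_half_le hR ht
  rw [hleft]
  calc _ ≤ ‖∫ r in (0 : ℝ)..R, Complex.exp (Complex.I * r * (-t)) * (phiK R r : ℂ)‖ +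
        ‖∫ r in (0 : ℝ)..R, Complex.exp (Complex.I * r * t) * (phiK R r : ℂ)‖ := norm_add_le _ _
    _ ≤ _ := add_le_add hb1 hb2
    _ = _ := by ring

/-! ## Assembly: `F_R(t) ≪_R (‖t‖ + 1)^{-5/2}` in the strip `|Im t| < 1` -/

/-- A crude bound valid for all `t` in the strip: `‖F_R(t)‖ ≤ e^{R} · 2R · cosh R^{3/2}`.
[folklore] -/
theorem norm_coshKernelFourier_le_const (hR : 0 < R) {t : ℂ} (ht : |t.im| < 1) :
    ‖coshKernelFourier R t‖ ≤ Real.exp R * (2 * R * Real.sqrt (cosh R) ^ 3) := by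
  have hRR : -R ≤ R := by linarith
  have hM : ∀ r ∈ Icc (-R) R, |r| ≤ R := fun r hr => abs_le.mpr hr
  have hfI : IntervalIntegrable (fun r => (coshKernel R r : ℂ)) volume (-R) R :=
    intervalIntegrable_ofReal ((continuous_coshKernel R).intervalIntegrable _ _)
  have h1 := norm_integral_cexp_mul_le hRR hM t hfI
  unfold coshKernelFourier
  refine h1.trans ?_
  have hE : Real.exp (R * |t.im|) ≤ Real.exp R := by
    apply Real.exp_le_exp.mpr
    nlinarith [abs_nonneg t.im]
  have hI : ∫ r in (-R)..R, ‖(coshKernel R r : ℂ)‖ ≤ 2 * R * Real.sqrt (cosh R) ^ 3 := by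
    calc ∫ r in (-R)..R, ‖(coshKernel R r : ℂ)‖ ≤ ∫ r in (-R)..R, Real.sqrt (cosh R) ^ 3 := by
          apply intervalIntegral.integral_mono_on hRR hfI.norm intervalIntegrable_const
          intro r _
          rw [Complex.norm_real, Real.norm_of_nonneg (coshKernel_nonneg R r)]
          exact coshKernel_le R r
      _ = 2 * R * Real.sqrt (cosh R) ^ 3 := by
          rw [intervalIntegral.integral_const, smul_eq_mul]; ring
  have hI0 : 0 ≤ ∫ r in (-R)..R, ‖(coshKernel R r : ℂ)‖ :=
    intervalIntegral.integral_nonneg hRR (fun r _ => norm_nonneg _)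
  calc Real.exp (R * |t.im|) * ∫ r in (-R)..R, ‖(coshKernel R r : ℂ)‖
      ≤ Real.exp R * ∫ r in (-R)..R, ‖(coshKernel R r : ℂ)‖ := mul_le_mul_of_nonneg_right hE hI0
    _ ≤ Real.exp R * (2 * R * Real.sqrt (cosh R) ^ 3) := mul_le_mul_of_nonneg_left hI (Real.exp_pos R).le

/-- The decay for large `‖t‖`: `‖t‖² ‖F_R(t)‖ ≤ e^{R|Im t|} (12 K + (3/2) C_χ) ‖t‖^{-1/2}` for
`‖t‖ ≥ max(1, 1/R)`. [folklore] -/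
theorem norm_coshKernelFourier_le_large (hR : 0 < R) {t : ℂ} (ht1 : 1 ≤ ‖t‖) (htR : R⁻¹ ≤ ‖t‖) :
    ‖t‖ ^ 2 * ‖coshKernelFourier R t‖ ≤
      Real.exp (R * |t.im|) * (12 * (sinh R ^ 2 * (Real.sqrt (sinh (R / 2)))⁻¹) +
        3 / 2 * ∫ r in (-R)..R, |chiKDeriv R r|) * ‖t‖ ^ (-(1 / 2 : ℝ)) := by
  have hnorm : 0 < ‖t‖ := by linarith
  have ht0 : t ≠ 0 := norm_pos_iff.mp hnorm
  have hRR : -R ≤ R := by linarith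
  set K : ℝ := sinh R ^ 2 * (Real.sqrt (sinh (R / 2)))⁻¹ with hK
  set E : ℝ := Real.exp (R * |t.im|) with hE
  set Cχ : ℝ := ∫ r in (-R)..R, |chiKDeriv R r| with hCχ
  have hK0 : 0 ≤ K := by rw [hK]; positivity
  have hE0 : 0 < E := Real.exp_pos _
  have hCχ0 : 0 ≤ Cχ := intervalIntegral.integral_nonneg hRR (fun r _ => abs_nonneg _)
  -- `(it)² F = ∫ e f'' = (3/4) ∫ e φ - (3/2) ∫ e χ`
  have hsq := sq_mul_coshKernelFourier hR t
  have hφI : IntervalIntegrable (fun r => Complex.exp (Complex.I * r * t) * (phiK R r : ℂ)) volume (-R) R :=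
    (intervalIntegrable_ofReal (intervalIntegrable_phiK hR)).continuousOn_mul
      (continuous_cexp_mul t).continuousOn
  have hχI : IntervalIntegrable (fun r => Complex.exp (Complex.I * r * t) * (chiK R r : ℂ)) volume (-R) R :=
    ((continuous_cexp_mul t).mul (Complex.continuous_ofReal.comp (continuous_chiK R))).intervalIntegrable _ _
  have hsplit : ∫ r in (-R)..R, Complex.exp (Complex.I * r * t) * (coshKernelDeriv2 R r : ℂ) =
      3 / 4 * (∫ r in (-R)..R, Complex.exp (Complex.I * r * t) * (phiK R r : ℂ)) -
        3 / 2 * (∫ r in (-R)..R, Complex.exp (Complex.I * r * t) * (chiK R r : ℂ)) := by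
    rw [← intervalIntegral.integral_const_mul, ← intervalIntegral.integral_const_mul,
      ← intervalIntegral.integral_sub (hφI.const_mul _) (hχI.const_mul _)]
    refine intervalIntegral.integral_congr (fun r _ => ?_)
    simp only [coshKernelDeriv2_eq]
    push_cast
    ring
  have hφb := norm_integral_cexp_phiK_le hR htR
  have hχb := norm_integral_cexp_chiK_le hR ht0
  have hinv : ‖t‖⁻¹ ≤ ‖t‖ ^ (-(1 / 2 : ℝ)) := by
    rw [← Real.rpow_neg_one]
    exact Real.rpow_le_rpow_of_exponent_le ht1 (by norm_num)
  have hlhs : ‖t‖ ^ 2 * ‖coshKernelFourier R t‖ = ‖(Complex.I * t) ^ 2 * coshKernelFourier R t‖ := by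
    rw [norm_mul, norm_pow, norm_mul, Complex.norm_I, one_mul]
  rw [hlhs, hsq, hsplit]
  calc ‖3 / 4 * (∫ r in (-R)..R, Complex.exp (Complex.I * r * t) * (phiK R r : ℂ)) -
        3 / 2 * (∫ r in (-R)..R, Complex.exp (Complex.I * r * t) * (chiK R r : ℂ))‖
      ≤ ‖3 / 4 * (∫ r in (-R)..R, Complex.exp (Complex.I * r * t) * (phiK R r : ℂ))‖ +
        ‖3 / 2 * (∫ r in (-R)..R, Complex.exp (Complex.I * r * t) * (chiK R r : ℂ))‖ := norm_sub_le _ _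
    _ = 3 / 4 * ‖∫ r in (-R)..R, Complex.exp (Complex.I * r * t) * (phiK R r : ℂ)‖ +
        3 / 2 * ‖∫ r in (-R)..R, Complex.exp (Complex.I * r * t) * (chiK R r : ℂ)‖ := by
        rw [norm_mul, norm_mul]; norm_num
    _ ≤ 3 / 4 * (16 * E * K * ‖t‖ ^ (-(1 / 2 : ℝ))) + 3 / 2 * (E * Cχ / ‖t‖) := by
        gcongr
    _ = E * (12 * K) * ‖t‖ ^ (-(1 / 2 : ℝ)) + E * (3 / 2 * Cχ) * ‖t‖⁻¹ := by ring
    _ ≤ E * (12 * K) * ‖t‖ ^ (-(1 / 2 : ℝ)) + E * (3 / 2 * Cχ) * ‖t‖ ^ (-(1 / 2 : ℝ)) := by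
        gcongr
    _ = E * (12 * K + 3 / 2 * Cχ) * ‖t‖ ^ (-(1 / 2 : ℝ)) := by ring

/-- **Fourier decay of `(cosh R - cosh r)_+^{3/2}`**: for `R > 0` there is `A` with
`‖F_R(t)‖ ≤ A (‖t‖ + 1)^{-5/2}` throughout the strip `|Im t| < 1`. [folklore] -/
theorem coshKernelFourier_decay (hR : 0 < R) :
    ∃ A : ℝ, ∀ t : ℂ, |t.im| < 1 → ‖coshKernelFourier R t‖ ≤ A * (‖t‖ + 1) ^ (-(5 / 2 : ℝ)) := by
  set K : ℝ := sinh R ^ 2 * (Real.sqrt (sinh (R / 2)))⁻¹ with hK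
  set Cχ : ℝ := ∫ r in (-R)..R, |chiKDeriv R r| with hCχ
  have hRR : -R ≤ R := by linarith
  have hK0 : 0 ≤ K := by rw [hK]; positivity
  have hCχ0 : 0 ≤ Cχ := intervalIntegral.integral_nonneg hRR (fun r _ => abs_nonneg _)
  set T₀ : ℝ := max 1 R⁻¹ with hT₀
  have hT₀1 : 1 ≤ T₀ := le_max_left _ _
  set A₁ : ℝ := (2 : ℝ) ^ (5 / 2 : ℝ) * Real.exp R * (12 * K + 3 / 2 * Cχ) with hA₁
  set A₂ : ℝ := Real.exp R * (2 * R * Real.sqrt (cosh R) ^ 3) * (T₀ + 1) ^ (5 / 2 : ℝ) with hA₂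
  have hA₁0 : 0 ≤ A₁ := by rw [hA₁]; positivity
  have hA₂0 : 0 ≤ A₂ := by rw [hA₂]; positivity
  refine ⟨max A₁ A₂, fun t ht => ?_⟩
  have hpos : 0 < ‖t‖ + 1 := by positivity
  rcases lt_or_ge ‖t‖ T₀ with hsmall | hlarge
  · -- small `‖t‖`
    have h1 := norm_coshKernelFourier_le_const hR ht
    have h2 : (T₀ + 1) ^ (-(5 / 2 : ℝ)) ≤ (‖t‖ + 1) ^ (-(5 / 2 : ℝ)) :=
      Real.rpow_le_rpow_of_nonpos hpos (by linarith) (by norm_num)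
    have h3 : (T₀ + 1) ^ (5 / 2 : ℝ) * (T₀ + 1) ^ (-(5 / 2 : ℝ)) = 1 := by
      rw [← Real.rpow_add (by linarith)]; norm_num
    calc ‖coshKernelFourier R t‖ ≤ Real.exp R * (2 * R * Real.sqrt (cosh R) ^ 3) := h1
      _ = A₂ * (T₀ + 1) ^ (-(5 / 2 : ℝ)) := by rw [hA₂, mul_assoc _ ((T₀ + 1) ^ (5 / 2 : ℝ)), h3, mul_one]
      _ ≤ A₂ * (‖t‖ + 1) ^ (-(5 / 2 : ℝ)) := mul_le_mul_of_nonneg_left h2 hA₂0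
      _ ≤ max A₁ A₂ * (‖t‖ + 1) ^ (-(5 / 2 : ℝ)) :=
          mul_le_mul_of_nonneg_right (le_max_right _ _) (Real.rpow_nonneg hpos.le _)
  · -- large `‖t‖`
    have ht1 : 1 ≤ ‖t‖ := hT₀1.trans hlarge
    have htR : R⁻¹ ≤ ‖t‖ := (le_max_right _ _).trans hlarge
    have hnorm : 0 < ‖t‖ := by linarith
    have hbig := norm_coshKernelFourier_le_large hR ht1 htR
    have hE : Real.exp (R * |t.im|) ≤ Real.exp R := by
      apply Real.exp_le_exp.mpr; nlinarith [abs_nonneg t.im]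
    -- `‖t‖² ‖F‖ ≤ e^R (12K + 3/2 Cχ) ‖t‖^{-1/2}`
    have h1 : ‖t‖ ^ 2 * ‖coshKernelFourier R t‖ ≤
        Real.exp R * (12 * K + 3 / 2 * Cχ) * ‖t‖ ^ (-(1 / 2 : ℝ)) := by
      refine hbig.trans ?_
      gcongr
    -- divide by `‖t‖²`
    have h2 : ‖coshKernelFourier R t‖ ≤ Real.exp R * (12 * K + 3 / 2 * Cχ) * ‖t‖ ^ (-(5 / 2 : ℝ)) := by
      have hsq : 0 < ‖t‖ ^ 2 := by positivity
      rw [mul_comm] at h1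
      rw [← le_div_iff₀ hsq] at h1
      refine h1.trans (le_of_eq ?_)
      rw [mul_div_assoc]
      congr 1
      rw [div_eq_mul_inv, ← Real.rpow_natCast, ← Real.rpow_neg hnorm.le, ← Real.rpow_add hnorm]
      norm_num
    -- `‖t‖^{-5/2} ≤ 2^{5/2} (‖t‖ + 1)^{-5/2}`
    have h3 : ‖t‖ ^ (-(5 / 2 : ℝ)) ≤ (2 : ℝ) ^ (5 / 2 : ℝ) * (‖t‖ + 1) ^ (-(5 / 2 : ℝ)) := by
      have h4 : (‖t‖ + 1) ^ (-(5 / 2 : ℝ)) ≥ (2 * ‖t‖) ^ (-(5 / 2 : ℝ)) :=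
        Real.rpow_le_rpow_of_nonpos hpos (by linarith) (by norm_num)
      rw [Real.mul_rpow (by norm_num) hnorm.le] at h4
      have h5 : (2 : ℝ) ^ (5 / 2 : ℝ) * (2 : ℝ) ^ (-(5 / 2 : ℝ)) = 1 := by
        rw [← Real.rpow_add (by norm_num)]; norm_num
      calc ‖t‖ ^ (-(5 / 2 : ℝ)) = (2 : ℝ) ^ (5 / 2 : ℝ) * ((2 : ℝ) ^ (-(5 / 2 : ℝ)) * ‖t‖ ^ (-(5 / 2 : ℝ))) := by
            rw [← mul_assoc, h5, one_mul]
        _ ≤ (2 : ℝ) ^ (5 / 2 : ℝ) * (‖t‖ + 1) ^ (-(5 / 2 : ℝ)) :=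
            mul_le_mul_of_nonneg_left h4 (by positivity)
    have hc0 : 0 ≤ Real.exp R * (12 * K + 3 / 2 * Cχ) := by positivity
    calc ‖coshKernelFourier R t‖ ≤ Real.exp R * (12 * K + 3 / 2 * Cχ) * ‖t‖ ^ (-(5 / 2 : ℝ)) := h2
      _ ≤ Real.exp R * (12 * K + 3 / 2 * Cχ) * ((2 : ℝ) ^ (5 / 2 : ℝ) * (‖t‖ + 1) ^ (-(5 / 2 : ℝ))) :=
          mul_le_mul_of_nonneg_left h3 hc0
      _ = A₁ * (‖t‖ + 1) ^ (-(5 / 2 : ℝ)) := by rw [hA₁]; ring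
      _ ≤ max A₁ A₂ * (‖t‖ + 1) ^ (-(5 / 2 : ℝ)) :=
          mul_le_mul_of_nonneg_right (le_max_left _ _) (Real.rpow_nonneg hpos.le _)

/-- For `R = 0` the interval `[-R, R]` is degenerate, so `F_0 = 0`. [folklore] -/
theorem coshKernelFourier_zero (t : ℂ) : coshKernelFourier 0 t = 0 := by
  simp [coshKernelFourier]


/-! ## Closed form of the Selberg/Harish-Chandra transform of the lattice kernel -/

section LatticeClosedForm

variable {X Y : ℝ}

/-- The lattice kernel as a difference of two truncated linear functions:
`k(u) = (4/Y) ((b - u)_+ - (a - u)_+)`, `a = (X - 2)/4`, `b = (X + Y - 2)/4`.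
[cite: Iwaniec2002, Fig. 11, PDF p. 126] -/
theorem latticeKernel_eq_max_sub_max (hY : 0 < Y) (u : ℝ) :
    latticeKernel X Y u = 4 / Y * (max ((X + Y - 2) / 4 - u) 0 - max ((X - 2) / 4 - u) 0) := by
  rcases le_or_gt (4 * u + 2) X with h1 | h1
  · rw [latticeKernel_eq_one hY h1, max_eq_left (by linarith), max_eq_left (by linarith)]
    field_simp; ring
  rcases le_or_gt (4 * u + 2) (X + Y) with h2 | h2
  · rw [latticeKernel_eq_of_mem hY h1.le h2, max_eq_left (by linarith), max_eq_right (by linarith)]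
    field_simp; ring
  · rw [latticeKernel_eq_zero hY h2.le, max_eq_right (by linarith), max_eq_right (by linarith)]
    simp

/-- The Abel transform of a truncated linear function:
`∫_v^∞ (c - u)_+ (u - v)^{-1/2} du = (4/3) (c - v)_+^{3/2}` (integrability and value). [folklore] -/
theorem integral_max_sub_mul_rpow (c v : ℝ) :
    IntegrableOn (fun u => max (c - u) 0 * (u - v) ^ (-(1 / 2 : ℝ))) (Ioi v) ∧
      ∫ u in Ioi v, max (c - u) 0 * (u - v) ^ (-(1 / 2 : ℝ)) = 4 / 3 * Real.sqrt (c - v) ^ 3 := by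
  rcases le_or_gt c v with hcv | hcv
  · -- empty overlap
    have hzero : ∀ u ∈ Ioi v, max (c - u) 0 * (u - v) ^ (-(1 / 2 : ℝ)) = 0 := by
      intro u hu
      have hu' : v < u := hu
      rw [max_eq_right (by linarith), zero_mul]
    refine ⟨(integrableOn_congr_fun hzero measurableSet_Ioi).mpr integrableOn_zero, ?_⟩
    rw [setIntegral_congr_fun measurableSet_Ioi hzero, MeasureTheory.integral_zero,
      Real.sqrt_eq_zero'.mpr (by linarith)]
    ring
  · -- `v < c`
    have hsplit : Ioi v = Ioc v c ∪ Ioi c := (Ioc_union_Ioi_eq_Ioi hcv.le).symm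
    have hzero : ∀ u ∈ Ioi c, max (c - u) 0 * (u - v) ^ (-(1 / 2 : ℝ)) = 0 := by
      intro u hu
      have hu' : c < u := hu
      rw [max_eq_right (by linarith), zero_mul]
    have hrpow : IntervalIntegrable (fun u : ℝ => (u - v) ^ (-(1 / 2 : ℝ))) volume v c := by
      have h0 : IntervalIntegrable (fun x : ℝ => x ^ (-(1 / 2 : ℝ))) volume 0 (c - v) :=
        intervalIntegral.intervalIntegrable_rpow' (by norm_num)
      have h1 := h0.comp_sub_right v
      rwa [zero_add, sub_add_cancel] at h1
    have hII : IntervalIntegrable (fun u => max (c - u) 0 * (u - v) ^ (-(1 / 2 : ℝ))) volume v c :=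
      hrpow.continuousOn_mul (by fun_prop)
    have hI1 : IntegrableOn (fun u => max (c - u) 0 * (u - v) ^ (-(1 / 2 : ℝ))) (Ioc v c) :=
      (intervalIntegrable_iff_integrableOn_Ioc_of_le hcv.le).mp hII
    have hI2 : IntegrableOn (fun u => max (c - u) 0 * (u - v) ^ (-(1 / 2 : ℝ))) (Ioi c) :=
      (integrableOn_congr_fun hzero measurableSet_Ioi).mpr integrableOn_zero
    refine ⟨by rw [hsplit]; exact hI1.union hI2, ?_⟩
    rw [hsplit, setIntegral_union (Set.disjoint_left.mpr fun u hu1 hu2 => by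
        simp only [mem_Ioc] at hu1; simp only [mem_Ioi] at hu2; linarith) measurableSet_Ioi hI1 hI2,
      setIntegral_congr_fun measurableSet_Ioi hzero, MeasureTheory.integral_zero, add_zero,
      ← intervalIntegral.integral_of_le hcv.le]
    -- on `[v, c]` the integrand is `(c - u)(u - v)^{-1/2}`, with primitive
    -- `G(u) = 2 (c - v) √(u - v) - (2/3) √(u - v)³`
    have hcongr : ∫ u in v..c, max (c - u) 0 * (u - v) ^ (-(1 / 2 : ℝ)) =
        ∫ u in v..c, (c - u) * (u - v) ^ (-(1 / 2 : ℝ)) := by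
      refine intervalIntegral.integral_congr (fun u hu => ?_)
      rw [uIcc_of_le hcv.le] at hu
      simp only [max_eq_left (show (0 : ℝ) ≤ c - u by linarith [hu.2])]
    rw [hcongr]
    have hderiv : ∀ u ∈ Ioo v c, HasDerivWithinAt
        (fun u => 2 * (c - v) * Real.sqrt (u - v) - 2 / 3 * ((u - v) * Real.sqrt (u - v)))
        ((c - u) * (u - v) ^ (-(1 / 2 : ℝ))) (Ioi u) u := by
      intro u hu
      have huv : 0 < u - v := by linarith [hu.1]
      have hs : 0 < Real.sqrt (u - v) := Real.sqrt_pos.mpr huv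
      have h0 : HasDerivAt (fun u => u - v) 1 u := (hasDerivAt_id u).sub_const v
      have h1 : HasDerivAt (fun u => Real.sqrt (u - v)) (1 / (2 * Real.sqrt (u - v))) u := by
        have := h0.sqrt huv.ne'
        simpa using this
      have h2 := (h1.const_mul (2 * (c - v))).sub ((h0.mul h1).const_mul (2 / 3))
      apply HasDerivAt.hasDerivWithinAt
      refine h2.congr_deriv ?_
      have e : (u - v) ^ (-(1 / 2 : ℝ)) = 1 / Real.sqrt (u - v) := by
        rw [Real.sqrt_eq_rpow, Real.rpow_neg huv.le, inv_eq_one_div]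
      rw [e]
      have hsq : Real.sqrt (u - v) ^ 2 = u - v := Real.sq_sqrt huv.le
      field_simp
      linear_combination (-(2 : ℝ)) * hsq
    have hcont : ContinuousOn
        (fun u => 2 * (c - v) * Real.sqrt (u - v) - 2 / 3 * ((u - v) * Real.sqrt (u - v))) (Icc v c) := by
      fun_prop
    have hint : IntervalIntegrable (fun u => (c - u) * (u - v) ^ (-(1 / 2 : ℝ))) volume v c :=
      hrpow.continuousOn_mul (by fun_prop)
    rw [intervalIntegral.integral_eq_sub_of_hasDeriv_right_of_le hcv.le hcont hderiv hint]
    have hcv0 : 0 ≤ c - v := by linarith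
    have h3 : Real.sqrt (c - v) ^ 3 = (c - v) * Real.sqrt (c - v) := by
      rw [pow_succ, Real.sq_sqrt hcv0]
    simp only [sub_self, Real.sqrt_zero, mul_zero, sub_zero]
    rw [h3]
    ring

/-- **Closed form of `q` for the lattice kernel** (Iwaniec (1.62), first step, for the kernel of
Fig. 11): `q(v) = (16/(3Y)) ((b - v)_+^{3/2} - (a - v)_+^{3/2})`, `a = (X-2)/4`, `b = (X+Y-2)/4`.
[cite: Iwaniec2002, (1.62) & Fig. 11, PDF pp. 24, 126] -/
theorem selbergQ_latticeKernel (hY : 0 < Y) (v : ℝ) :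
    selbergQ (latticeKernel X Y) v =
      16 / (3 * Y) * (Real.sqrt ((X + Y - 2) / 4 - v) ^ 3 - Real.sqrt ((X - 2) / 4 - v) ^ 3) := by
  unfold selbergQ
  have hb := integral_max_sub_mul_rpow ((X + Y - 2) / 4) v
  have ha := integral_max_sub_mul_rpow ((X - 2) / 4) v
  have e : ∀ u, latticeKernel X Y u * (u - v) ^ (-(1 / 2 : ℝ)) =
      4 / Y * (max ((X + Y - 2) / 4 - u) 0 * (u - v) ^ (-(1 / 2 : ℝ)) -
        max ((X - 2) / 4 - u) 0 * (u - v) ^ (-(1 / 2 : ℝ))) := by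
    intro u; rw [latticeKernel_eq_max_sub_max hY]; ring
  simp_rw [e]
  rw [MeasureTheory.integral_const_mul, integral_sub hb.1 ha.1, hb.2, ha.2]
  field_simp
  ring

/-- `√((C - cosh r)/2)³ = √(C - cosh r)³ / (2 √2)` and `c - sinh²(r/2) = ((2c + 1) - cosh r)/2`.
[folklore] -/
theorem sqrt_sub_sinh_sq_half_pow_three (c r : ℝ) :
    Real.sqrt (c - sinh (r / 2) ^ 2) ^ 3 = Real.sqrt ((2 * c + 1) - cosh r) ^ 3 / (2 * Real.sqrt 2) := by
  have h1 : c - sinh (r / 2) ^ 2 = ((2 * c + 1) - cosh r) / 2 := by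
    have := Real.cosh_two_mul (r / 2)
    rw [show 2 * (r / 2) = r by ring, Real.cosh_sq] at this
    linarith
  rw [h1, Real.sqrt_div' _ (by norm_num : (0 : ℝ) ≤ 2), div_pow]
  have h2 : Real.sqrt 2 ^ 3 = 2 * Real.sqrt 2 := by
    rw [pow_succ, Real.sq_sqrt (by norm_num : (0 : ℝ) ≤ 2)]
  rw [h2]

/-- **Closed form of `g` for the lattice kernel**: with `cosh R_a = X/2`, `cosh R_b = (X + Y)/2`,
`g(r) = (16/(3√2 Y)) (f_{R_b}(r) - f_{R_a}(r)) = (8√2/(3Y)) (…)`, `f_R(r) = (cosh R - cosh r)_+^{3/2}`.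
[cite: Iwaniec2002, (1.62) & Fig. 11, PDF pp. 24, 126] -/
theorem selbergG_latticeKernel (hX : 2 ≤ X) (hY : 0 < Y) (r : ℝ) :
    selbergG (latticeKernel X Y) r =
      16 / (3 * Y * Real.sqrt 2) *
        (coshKernel (Real.arcosh ((X + Y) / 2)) r - coshKernel (Real.arcosh (X / 2)) r) := by
  unfold selbergG coshKernel
  rw [selbergQ_latticeKernel hY, Real.cosh_arcosh (by linarith), Real.cosh_arcosh (by linarith),
    show (X + Y - 2) / 4 = ((X + Y) / 2 - 1) / 2 by ring, show (X - 2) / 4 = (X / 2 - 1) / 2 by ring,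
    sqrt_sub_sinh_sq_half_pow_three, sqrt_sub_sinh_sq_half_pow_three,
    show 2 * (((X + Y) / 2 - 1) / 2) + 1 = (X + Y) / 2 by ring,
    show 2 * ((X / 2 - 1) / 2) + 1 = X / 2 by ring]
  have hs2 : Real.sqrt 2 ≠ 0 := by positivity
  field_simp

/-- The Fourier integral of `f_R` over `ℝ` is the interval integral `F_R` (support `[-R, R]`).
[folklore] -/
theorem integral_cexp_mul_coshKernel {R : ℝ} (hR : 0 ≤ R) (t : ℂ) :
    ∫ r : ℝ, Complex.exp (Complex.I * r * t) * (coshKernel R r : ℂ) = coshKernelFourier R t := by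
  unfold coshKernelFourier
  rw [intervalIntegral.integral_of_le (by linarith : -R ≤ R), ← integral_Icc_eq_integral_Ioc,
    ← setIntegral_eq_integral_of_forall_compl_eq_zero]
  intro r hr
  have h : R ≤ |r| := le_of_not_gt fun hlt => hr ⟨(abs_lt.mp hlt).1.le, (abs_lt.mp hlt).2.le⟩
  rw [coshKernel_eq_zero hR h]
  simp

/-- `e^{irt} f_R(r)` is integrable over `ℝ` (continuous, compact support). [folklore] -/
theorem integrable_cexp_mul_coshKernel (R : ℝ) (t : ℂ) :
    Integrable (fun r : ℝ => Complex.exp (Complex.I * r * t) * (coshKernel R r : ℂ)) := by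
  apply Continuous.integrable_of_hasCompactSupport
  · exact (continuous_cexp_mul t).mul (Complex.continuous_ofReal.comp (continuous_coshKernel R))
  · apply HasCompactSupport.of_support_subset_isCompact (isCompact_Icc (a := -|R|) (b := |R|))
    intro r hr
    by_contra hnot
    apply hr
    have h : |R| ≤ |r| :=
      le_of_not_gt fun hlt => hnot ⟨(abs_lt.mp hlt).1.le, (abs_lt.mp hlt).2.le⟩
    have h0 : coshKernel R r = 0 := by
      have : coshKernel R r = coshKernel |R| r := by simp [coshKernel]
      rw [this]
      exact coshKernel_eq_zero (abs_nonneg R) h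
    simp [h0]

/-- **Closed form of the Selberg/Harish-Chandra transform of the lattice kernel**:
`h(t) = (16/(3√2 Y)) (F_{R_b}(t) - F_{R_a}(t))`, `cosh R_a = X/2`, `cosh R_b = (X + Y)/2`,
`F_R(t) = ∫_{-R}^{R} e^{irt} (cosh R - cosh r)^{3/2} dr`.
[cite: Iwaniec2002, (1.62) & Fig. 11, PDF pp. 24, 126] -/
theorem selbergTransform_latticeKernel (hX : 2 ≤ X) (hY : 0 < Y) (t : ℂ) :
    selbergTransform (latticeKernel X Y) t =
      (16 / (3 * Y * Real.sqrt 2) : ℝ) *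
        (coshKernelFourier (Real.arcosh ((X + Y) / 2)) t - coshKernelFourier (Real.arcosh (X / 2)) t) := by
  unfold selbergTransform
  have e : ∀ r : ℝ, Complex.exp (Complex.I * r * t) * (selbergG (latticeKernel X Y) r : ℂ) =
      (16 / (3 * Y * Real.sqrt 2) : ℝ) *
        (Complex.exp (Complex.I * r * t) * (coshKernel (Real.arcosh ((X + Y) / 2)) r : ℂ) -
          Complex.exp (Complex.I * r * t) * (coshKernel (Real.arcosh (X / 2)) r : ℂ)) := by
    intro r
    rw [selbergG_latticeKernel hX hY]
    push_cast
    ring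
  simp_rw [e]
  rw [MeasureTheory.integral_const_mul,
    integral_sub (integrable_cexp_mul_coshKernel _ t) (integrable_cexp_mul_coshKernel _ t),
    integral_cexp_mul_coshKernel (Real.arcosh_nonneg (by linarith)) t,
    integral_cexp_mul_coshKernel (Real.arcosh_nonneg (by linarith)) t]

/-- Fourier decay of `f_R` for `R ≥ 0` (the case `R = 0` being trivial). [folklore] -/
theorem coshKernelFourier_decay' {R : ℝ} (hR : 0 ≤ R) :
    ∃ A : ℝ, 0 ≤ A ∧ ∀ t : ℂ, |t.im| < 1 → ‖coshKernelFourier R t‖ ≤ A * (‖t‖ + 1) ^ (-(5 / 2 : ℝ)) := by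
  rcases hR.lt_or_eq with hpos | hzero
  · obtain ⟨A, hA⟩ := coshKernelFourier_decay hpos
    refine ⟨max A 0, le_max_right _ _, fun t ht => (hA t ht).trans ?_⟩
    exact mul_le_mul_of_nonneg_right (le_max_left _ _) (Real.rpow_nonneg (by positivity) _)
  · refine ⟨0, le_rfl, fun t _ => ?_⟩
    rw [← hzero, coshKernelFourier_zero, norm_zero, zero_mul]

end LatticeClosedForm

end SelbergDecay

open SelbergDecay in
/-- **The kernel of Fig. 11 is admissible** (discharge of `Iwaniec2002_latticeKernel_admissible`):
for `X ≥ 2Y ≥ 2` the transform `h` of `k_{X,Y}` satisfies (1.63) with `ε = 1/2`, i.e. it is even,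
entire, and `h(t) ≪_{X,Y} (|t| + 1)^{-5/2}` in the strip `|Im t| < 1` — by the closed form
`h = (16/(3√2 Y))(F_{R_b} - F_{R_a})` and the decay of `F_R` (two integrations by parts and the
inverse-square-root endpoint singularity of `f_R''`). [cite: Iwaniec2002, (1.63) & proof of Thm 12.1, PDF pp. 24, 126] -/
theorem Iwaniec2002_latticeKernel_admissible_holds : Iwaniec2002_latticeKernel_admissible := by
  intro X Y hY hXY
  have hX : 2 ≤ X := by linarith
  have hY0 : 0 < Y := by linarith
  obtain ⟨Ab, hAb0, hAb⟩ := coshKernelFourier_decay' (Real.arcosh_nonneg (by linarith : (1 : ℝ) ≤ (X + Y) / 2))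
  obtain ⟨Aa, hAa0, hAa⟩ := coshKernelFourier_decay' (Real.arcosh_nonneg (by linarith : (1 : ℝ) ≤ X / 2))
  refine isAdmissibleTransform_of_decay (isTestKernel_latticeKernel X hY0) (ε := 1 / 2)
    (A := 16 / (3 * Y * Real.sqrt 2) * (Ab + Aa)) (by norm_num) (fun t ht => ?_)
  have ht1 : |t.im| < 1 := by linarith
  rw [selbergTransform_latticeKernel hX hY0, norm_mul, Complex.norm_real,
    Real.norm_of_nonneg (by positivity), show -(2 + 1 / 2 : ℝ) = -(5 / 2 : ℝ) by norm_num]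
  have hc : 0 ≤ 16 / (3 * Y * Real.sqrt 2) := by positivity
  calc 16 / (3 * Y * Real.sqrt 2) *
        ‖coshKernelFourier (Real.arcosh ((X + Y) / 2)) t - coshKernelFourier (Real.arcosh (X / 2)) t‖
      ≤ 16 / (3 * Y * Real.sqrt 2) *
        (‖coshKernelFourier (Real.arcosh ((X + Y) / 2)) t‖ + ‖coshKernelFourier (Real.arcosh (X / 2)) t‖) :=
        mul_le_mul_of_nonneg_left (norm_sub_le _ _) hc
    _ ≤ 16 / (3 * Y * Real.sqrt 2) *
        (Ab * (‖t‖ + 1) ^ (-(5 / 2 : ℝ)) + Aa * (‖t‖ + 1) ^ (-(5 / 2 : ℝ))) :=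
        mul_le_mul_of_nonneg_left (add_le_add (hAb t ht1) (hAa t ht1)) hc
    _ = 16 / (3 * Y * Real.sqrt 2) * (Ab + Aa) * (‖t‖ + 1) ^ (-(5 / 2 : ℝ)) := by ring

/-! # Part II. The transform at `t = i(s - 1/2)`: (12.8) for `1/2 < s ≤ 1` -/

namespace SelbergDecay

open MeasureTheory Set Filter Real intervalIntegral
open scoped Topology

/-! ## A. The exact factorisation `C - cosh r = (E/2)(1 - eʳ/E)(1 - e⁻ʳ/E)`, `E = e^{arcosh C}` -/

variable {C : ℝ}

/-- `E = C + √(C² - 1) = e^{arcosh C}` satisfies `E ≥ 1`, `E⁻¹ = C - √(C² - 1)` and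
`E + E⁻¹ = 2C` (for `C ≥ 1`). [folklore] -/
theorem exp_arcosh_add_inv (hC : 1 ≤ C) :
    Real.exp (Real.arcosh C) + (Real.exp (Real.arcosh C))⁻¹ = 2 * C := by
  have h := Real.cosh_eq (Real.arcosh C)
  rw [Real.cosh_arcosh hC, Real.exp_neg] at h
  linarith

/-- `e^{arcosh C} ≥ 1`. [folklore] -/
theorem one_le_exp_arcosh (hC : 1 ≤ C) : 1 ≤ Real.exp (Real.arcosh C) :=
  Real.one_le_exp (Real.arcosh_nonneg hC)

/-- `e^{arcosh C} ≤ 2C`. [folklore] -/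
theorem exp_arcosh_le (hC : 1 ≤ C) : Real.exp (Real.arcosh C) ≤ 2 * C := by
  have h := exp_arcosh_add_inv hC
  have : 0 < (Real.exp (Real.arcosh C))⁻¹ := inv_pos.mpr (Real.exp_pos _)
  linarith

/-- `C ≤ e^{arcosh C}`. [folklore] -/
theorem le_exp_arcosh (hC : 1 ≤ C) : C ≤ Real.exp (Real.arcosh C) := by
  rw [Real.exp_arcosh hC]
  have : 0 ≤ Real.sqrt (C ^ 2 - 1) := Real.sqrt_nonneg _
  linarith

/-- `2C - 1/C ≤ e^{arcosh C}` (as `E⁻¹ ≤ C⁻¹`). [folklore] -/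
theorem two_mul_sub_inv_le_exp_arcosh (hC : 1 ≤ C) : 2 * C - C⁻¹ ≤ Real.exp (Real.arcosh C) := by
  have h := exp_arcosh_add_inv hC
  have hE := le_exp_arcosh hC
  have hC0 : 0 < C := by linarith
  have : (Real.exp (Real.arcosh C))⁻¹ ≤ C⁻¹ := inv_anti₀ hC0 hE
  linarith

/-- The exact factorisation: `C - cosh r = (E/2)(1 - eʳ/E)(1 - e⁻ʳ/E)` with `E = e^{arcosh C}`. [folklore] -/
theorem sub_cosh_eq_factor (hC : 1 ≤ C) (r : ℝ) :
    C - cosh r = Real.exp (Real.arcosh C) / 2 *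
      ((1 - Real.exp r / Real.exp (Real.arcosh C)) * (1 - Real.exp (-r) / Real.exp (Real.arcosh C))) := by
  set E := Real.exp (Real.arcosh C) with hE
  have hE0 : E ≠ 0 := (Real.exp_pos _).ne'
  have h := exp_arcosh_add_inv hC
  rw [← hE] at h
  have hcosh : cosh r = (Real.exp r + Real.exp (-r)) / 2 := Real.cosh_eq r
  have hexp : Real.exp r * Real.exp (-r) = 1 := by rw [← Real.exp_add, add_neg_cancel, Real.exp_zero]
  have hC' : C = (E + E⁻¹) / 2 := by linarith
  rw [hcosh, hC']
  field_simp
  linear_combination (-1 : ℝ) * hexp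

/-- In the shifted variable `r = ρ - R` (`R = arcosh C`, `E = e^{R}`):
`C - cosh(ρ - R) = (E/2)(1 - e^{ρ - 2R})(1 - e^{-ρ})`. [folklore] -/
theorem sub_cosh_shift (hC : 1 ≤ C) (ρ : ℝ) :
    C - cosh (ρ - Real.arcosh C) = Real.exp (Real.arcosh C) / 2 *
      ((1 - Real.exp (ρ - 2 * Real.arcosh C)) * (1 - Real.exp (-ρ))) := by
  rw [sub_cosh_eq_factor hC]
  have h1 : Real.exp (ρ - Real.arcosh C) / Real.exp (Real.arcosh C) = Real.exp (ρ - 2 * Real.arcosh C) := by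
    rw [div_eq_iff (Real.exp_pos _).ne', ← Real.exp_add]; ring_nf
  have h2 : Real.exp (-(ρ - Real.arcosh C)) / Real.exp (Real.arcosh C) = Real.exp (-ρ) := by
    rw [div_eq_iff (Real.exp_pos _).ne', ← Real.exp_add]; ring_nf
  rw [h1, h2]

/-! ## B. `𝒢_σ(C) = ∫_{-R}^{R} e^{-rσ} (C - cosh r)^{1/2} dr` in the shifted variable -/

/-- The truncated Beta-type integral `∫_0^L e^{-ρσ} √(1 - e^{-ρ}) √(1 - e^{ρ-L}) dρ`. [folklore] -/
def betaTrunc (σ L : ℝ) : ℝ :=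
  ∫ ρ in (0 : ℝ)..L, Real.exp (-(ρ * σ)) * (Real.sqrt (1 - Real.exp (-ρ)) * Real.sqrt (1 - Real.exp (ρ - L)))

/-- The half-order profile integral `𝒢_σ(C) = ∫_{-R}^{R} e^{-rσ} √(C - cosh r) dr`, `R = arcosh C`. [folklore] -/
def gHalf (σ C : ℝ) : ℝ :=
  ∫ r in (-Real.arcosh C)..Real.arcosh C, Real.exp (-(r * σ)) * Real.sqrt (C - cosh r)

/-- **Substitution `r = ρ - R`**: `𝒢_σ(C) = √(E/2) · E^σ · betaTrunc σ (2R)`, `E = e^{R}`,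
`R = arcosh C` (uses the exact factorisation of `C - cosh r`). [folklore] -/
theorem gHalf_eq (hC : 1 ≤ C) (σ : ℝ) :
    gHalf σ C = Real.sqrt (Real.exp (Real.arcosh C) / 2) * Real.exp (Real.arcosh C * σ) *
      betaTrunc σ (2 * Real.arcosh C) := by
  set R := Real.arcosh C with hR
  have hR0 : 0 ≤ R := Real.arcosh_nonneg hC
  unfold gHalf betaTrunc
  have hsub := intervalIntegral.integral_comp_sub_right
    (fun r => Real.exp (-(r * σ)) * Real.sqrt (C - cosh r)) R (a := 0) (b := 2 * R)
  rw [zero_sub, show 2 * R - R = R by ring] at hsub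
  rw [← hsub, ← intervalIntegral.integral_const_mul]
  refine intervalIntegral.integral_congr (fun ρ hρ => ?_)
  rw [uIcc_of_le (by linarith)] at hρ
  have h1 : 0 ≤ 1 - Real.exp (ρ - 2 * R) := by
    have : Real.exp (ρ - 2 * R) ≤ 1 := Real.exp_le_one_iff.mpr (by linarith [hρ.2])
    linarith
  have h2 : 0 ≤ 1 - Real.exp (-ρ) := by
    have : Real.exp (-ρ) ≤ 1 := Real.exp_le_one_iff.mpr (by linarith [hρ.1])
    linarith
  have hE : 0 ≤ Real.exp R / 2 := by positivity
  have hfac : C - cosh (ρ - R) = Real.exp R / 2 * ((1 - Real.exp (ρ - 2 * R)) * (1 - Real.exp (-ρ))) := by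
    rw [hR]; exact sub_cosh_shift hC ρ
  have hexp : Real.exp (-((ρ - R) * σ)) = Real.exp (R * σ) * Real.exp (-(ρ * σ)) := by
    rw [← Real.exp_add]; ring_nf
  show Real.exp (-((ρ - R) * σ)) * Real.sqrt (C - cosh (ρ - R)) =
    Real.sqrt (Real.exp R / 2) * Real.exp (R * σ) *
      (Real.exp (-(ρ * σ)) * (Real.sqrt (1 - Real.exp (-ρ)) * Real.sqrt (1 - Real.exp (ρ - 2 * R))))
  rw [hfac, Real.sqrt_mul hE, Real.sqrt_mul h1, hexp]
  ring

/-! ## C. Truncation errors against the complete Beta integral -/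

variable {σ : ℝ}

/-- The complete integral `B_σ = ∫_0^∞ e^{-ρσ} √(1 - e^{-ρ}) dρ` (`= B(σ, 3/2)`, part D). [folklore] -/
def betaHalf (σ : ℝ) : ℝ := ∫ ρ in Ioi (0 : ℝ), Real.exp (-(ρ * σ)) * Real.sqrt (1 - Real.exp (-ρ))

/-- `√(1 - e^{-ρ}) ≤ 1`. [folklore] -/
theorem sqrt_one_sub_exp_neg_le_one (ρ : ℝ) : Real.sqrt (1 - Real.exp (-ρ)) ≤ 1 := by
  rw [Real.sqrt_le_one]  -- `√x ≤ 1 ↔ x ≤ 1`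
  linarith [Real.exp_pos (-ρ)]

/-- `0 ≤ √(1 - e^{-ρ})`. [folklore] -/
theorem sqrt_one_sub_exp_neg_nonneg (ρ : ℝ) : 0 ≤ Real.sqrt (1 - Real.exp (-ρ)) := Real.sqrt_nonneg _

/-- The integrand of `B_σ` is integrable on `(a, ∞)` for `σ > 0`. [folklore] -/
theorem integrableOn_betaHalf_integrand (hσ : 0 < σ) (a : ℝ) :
    IntegrableOn (fun ρ => Real.exp (-(ρ * σ)) * Real.sqrt (1 - Real.exp (-ρ))) (Ioi a) := by
  have h : IntegrableOn (fun x : ℝ => Real.exp (-σ * x)) (Ioi a) := exp_neg_integrableOn_Ioi a hσ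
  refine Integrable.mono' h ?_ ?_
  · exact (by fun_prop : Measurable fun ρ => Real.exp (-(ρ * σ)) * Real.sqrt (1 - Real.exp (-ρ))).aestronglyMeasurable
  · refine ae_of_all _ (fun ρ => ?_)
    rw [Real.norm_eq_abs, abs_of_nonneg (mul_nonneg (Real.exp_pos _).le (Real.sqrt_nonneg _)),
      show -σ * ρ = -(ρ * σ) by ring]
    exact mul_le_of_le_one_right (Real.exp_pos _).le (sqrt_one_sub_exp_neg_le_one ρ)

/-- Tail: `0 ≤ B_σ - ∫_0^L e^{-ρσ}√(1 - e^{-ρ}) dρ ≤ e^{-Lσ}/σ`. [folklore] -/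
theorem betaHalf_sub_trunc (hσ : 0 < σ) {L : ℝ} (hL : 0 ≤ L) :
    0 ≤ betaHalf σ - ∫ ρ in (0 : ℝ)..L, Real.exp (-(ρ * σ)) * Real.sqrt (1 - Real.exp (-ρ)) ∧
    betaHalf σ - ∫ ρ in (0 : ℝ)..L, Real.exp (-(ρ * σ)) * Real.sqrt (1 - Real.exp (-ρ)) ≤
      Real.exp (-(L * σ)) / σ := by
  have hint := integrableOn_betaHalf_integrand hσ 0
  have hintL := integrableOn_betaHalf_integrand hσ L
  have hsplit : betaHalf σ - ∫ ρ in (0 : ℝ)..L, Real.exp (-(ρ * σ)) * Real.sqrt (1 - Real.exp (-ρ)) =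
      ∫ ρ in Ioi L, Real.exp (-(ρ * σ)) * Real.sqrt (1 - Real.exp (-ρ)) := by
    unfold betaHalf
    rw [← intervalIntegral.integral_Ioi_sub_Ioi hint hL]
    ring
  rw [hsplit]
  constructor
  · exact setIntegral_nonneg measurableSet_Ioi (fun ρ _ =>
      mul_nonneg (Real.exp_pos _).le (Real.sqrt_nonneg _))
  · have hexpint : IntegrableOn (fun ρ => Real.exp (-σ * ρ)) (Ioi L) := exp_neg_integrableOn_Ioi L hσ
    calc ∫ ρ in Ioi L, Real.exp (-(ρ * σ)) * Real.sqrt (1 - Real.exp (-ρ))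
        ≤ ∫ ρ in Ioi L, Real.exp (-σ * ρ) := by
          apply setIntegral_mono_on hintL hexpint measurableSet_Ioi
          intro ρ _
          rw [show -σ * ρ = -(ρ * σ) by ring]
          exact mul_le_of_le_one_right (Real.exp_pos _).le (sqrt_one_sub_exp_neg_le_one ρ)
      _ = Real.exp (-(L * σ)) / σ := by
          rw [integral_exp_mul_Ioi (by linarith : -σ < 0)]
          rw [show -σ * L = -(L * σ) by ring]
          field_simp

/-- `1 - √(1 - x) ≤ x` for `0 ≤ x ≤ 1`. [folklore] -/
theorem one_sub_sqrt_one_sub_le {x : ℝ} (hx0 : 0 ≤ x) (hx1 : x ≤ 1) : 1 - Real.sqrt (1 - x) ≤ x := by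
  have h : 1 - x ≤ Real.sqrt (1 - x) := by
    have h1 : 0 ≤ 1 - x := by linarith
    calc 1 - x = Real.sqrt (1 - x) * Real.sqrt (1 - x) := (Real.mul_self_sqrt h1).symm
      _ ≤ Real.sqrt (1 - x) * 1 :=
          mul_le_mul_of_nonneg_left (Real.sqrt_le_one.mpr (by linarith)) (Real.sqrt_nonneg _)
      _ = Real.sqrt (1 - x) := mul_one _
  linarith

/-- `∫_a^b e^{cx} dx = (e^{cb} - e^{ca})/c` for `c ≠ 0`. [folklore] -/
theorem integral_exp_const_mul {a b c : ℝ} (hc : c ≠ 0) :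
    ∫ x in a..b, Real.exp (c * x) = (Real.exp (c * b) - Real.exp (c * a)) / c := by
  rw [intervalIntegral.integral_comp_mul_left (fun x => Real.exp x) hc, integral_exp, smul_eq_mul]
  field_simp

/-- Truncation: `0 ≤ ∫_0^L e^{-ρσ}√(1 - e^{-ρ}) dρ - betaTrunc σ L ≤ e^{-Lσ}/(1 - σ)` for `0 < σ < 1`,
`L ≥ 0`. [folklore] -/
theorem trunc_sub_betaTrunc (hσ1 : σ < 1) {L : ℝ} (hL : 0 ≤ L) :
    0 ≤ (∫ ρ in (0 : ℝ)..L, Real.exp (-(ρ * σ)) * Real.sqrt (1 - Real.exp (-ρ))) - betaTrunc σ L ∧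
    (∫ ρ in (0 : ℝ)..L, Real.exp (-(ρ * σ)) * Real.sqrt (1 - Real.exp (-ρ))) - betaTrunc σ L ≤
      Real.exp (-(L * σ)) / (1 - σ) := by
  unfold betaTrunc
  have hI1 : IntervalIntegrable (fun ρ => Real.exp (-(ρ * σ)) * Real.sqrt (1 - Real.exp (-ρ))) volume 0 L :=
    (by fun_prop : Continuous fun ρ => Real.exp (-(ρ * σ)) * Real.sqrt (1 - Real.exp (-ρ))).intervalIntegrable _ _
  have hI2 : IntervalIntegrable (fun ρ => Real.exp (-(ρ * σ)) *
      (Real.sqrt (1 - Real.exp (-ρ)) * Real.sqrt (1 - Real.exp (ρ - L)))) volume 0 L :=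
    (by fun_prop : Continuous fun ρ => Real.exp (-(ρ * σ)) *
      (Real.sqrt (1 - Real.exp (-ρ)) * Real.sqrt (1 - Real.exp (ρ - L)))).intervalIntegrable _ _
  rw [← intervalIntegral.integral_sub hI1 hI2]
  have hpt : ∀ ρ ∈ Icc 0 L,
      0 ≤ Real.exp (-(ρ * σ)) * Real.sqrt (1 - Real.exp (-ρ)) -
          Real.exp (-(ρ * σ)) * (Real.sqrt (1 - Real.exp (-ρ)) * Real.sqrt (1 - Real.exp (ρ - L))) ∧
      Real.exp (-(ρ * σ)) * Real.sqrt (1 - Real.exp (-ρ)) -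
          Real.exp (-(ρ * σ)) * (Real.sqrt (1 - Real.exp (-ρ)) * Real.sqrt (1 - Real.exp (ρ - L))) ≤
        Real.exp (-L) * Real.exp ((1 - σ) * ρ) := by
    intro ρ hρ
    have hx0 : 0 ≤ Real.exp (ρ - L) := (Real.exp_pos _).le
    have hx1 : Real.exp (ρ - L) ≤ 1 := Real.exp_le_one_iff.mpr (by linarith [hρ.2])
    have hs0 := sqrt_one_sub_exp_neg_nonneg ρ
    have hs1 := sqrt_one_sub_exp_neg_le_one ρ
    have hq1 : Real.sqrt (1 - Real.exp (ρ - L)) ≤ 1 := Real.sqrt_le_one.mpr (by linarith)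
    have hq := one_sub_sqrt_one_sub_le hx0 hx1
    have he : 0 < Real.exp (-(ρ * σ)) := Real.exp_pos _
    have factor : Real.exp (-(ρ * σ)) * Real.sqrt (1 - Real.exp (-ρ)) -
        Real.exp (-(ρ * σ)) * (Real.sqrt (1 - Real.exp (-ρ)) * Real.sqrt (1 - Real.exp (ρ - L))) =
        Real.exp (-(ρ * σ)) * Real.sqrt (1 - Real.exp (-ρ)) * (1 - Real.sqrt (1 - Real.exp (ρ - L))) := by
      ring
    rw [factor]
    constructor
    · exact mul_nonneg (mul_nonneg he.le hs0) (by linarith)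
    · have hexp : Real.exp (-L) * Real.exp ((1 - σ) * ρ) = Real.exp (-(ρ * σ)) * Real.exp (ρ - L) := by
        rw [← Real.exp_add, ← Real.exp_add]; ring_nf
      rw [hexp]
      calc Real.exp (-(ρ * σ)) * Real.sqrt (1 - Real.exp (-ρ)) * (1 - Real.sqrt (1 - Real.exp (ρ - L)))
          ≤ Real.exp (-(ρ * σ)) * 1 * Real.exp (ρ - L) := by
            apply mul_le_mul (mul_le_mul_of_nonneg_left hs1 he.le) hq (by linarith) (by positivity)
        _ = Real.exp (-(ρ * σ)) * Real.exp (ρ - L) := by ring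
  constructor
  · apply intervalIntegral.integral_nonneg hL
    intro ρ hρ
    exact (hpt ρ hρ).1
  · have hI3 : IntervalIntegrable (fun ρ => Real.exp (-L) * Real.exp ((1 - σ) * ρ)) volume 0 L :=
      (by fun_prop : Continuous fun ρ => Real.exp (-L) * Real.exp ((1 - σ) * ρ)).intervalIntegrable _ _
    calc ∫ ρ in (0 : ℝ)..L, Real.exp (-(ρ * σ)) * Real.sqrt (1 - Real.exp (-ρ)) -
          Real.exp (-(ρ * σ)) * (Real.sqrt (1 - Real.exp (-ρ)) * Real.sqrt (1 - Real.exp (ρ - L)))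
        ≤ ∫ ρ in (0 : ℝ)..L, Real.exp (-L) * Real.exp ((1 - σ) * ρ) :=
          intervalIntegral.integral_mono_on hL (hI1.sub hI2) hI3 (fun ρ hρ => (hpt ρ hρ).2)
      _ = Real.exp (-L) * ((Real.exp ((1 - σ) * L) - Real.exp ((1 - σ) * 0)) / (1 - σ)) := by
          rw [intervalIntegral.integral_const_mul, integral_exp_const_mul (by linarith : (1 - σ) ≠ 0)]
      _ ≤ Real.exp (-(L * σ)) / (1 - σ) := by
          rw [mul_zero, Real.exp_zero, mul_div_assoc']
          apply div_le_div_of_nonneg_right _ (by linarith)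
          rw [mul_sub, ← Real.exp_add, show -L + (1 - σ) * L = -(L * σ) by ring, mul_one]
          linarith [Real.exp_pos (-L)]

/-! ## D. `B_σ = B(σ, 3/2) = Γ(σ) Γ(3/2) / Γ(σ + 3/2)` -/

/-- The image of `(0, ∞)` under `ρ ↦ e^{-ρ}` is `(0, 1)`. [folklore] -/
theorem image_exp_neg_Ioi : (fun ρ : ℝ => Real.exp (-ρ)) '' Ioi 0 = Ioo 0 1 := by
  ext x
  constructor
  · rintro ⟨ρ, hρ, rfl⟩
    exact ⟨Real.exp_pos _, Real.exp_lt_one_iff.mpr (by simpa using hρ)⟩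
  · rintro ⟨hx0, hx1⟩
    refine ⟨-Real.log x, ?_, ?_⟩
    · simpa using Real.log_neg hx0 hx1
    · simp [Real.exp_log hx0]

/-- Change of variables `x = e^{-ρ}`: `B_σ = ∫_0^1 x^{σ-1} √(1 - x) dx`. [folklore] -/
theorem betaHalf_eq_integral_rpow (σ : ℝ) :
    betaHalf σ = ∫ x in Ioo (0 : ℝ) 1, x ^ (σ - 1) * Real.sqrt (1 - x) := by
  have hderiv : ∀ ρ ∈ Ioi (0 : ℝ), HasDerivWithinAt (fun ρ : ℝ => Real.exp (-ρ)) (-Real.exp (-ρ)) (Ioi 0) ρ :=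
    fun ρ _ => ((Real.hasDerivAt_exp (-ρ)).comp ρ (hasDerivAt_neg ρ) |>.hasDerivWithinAt).congr_deriv (by ring)
  have hinj : InjOn (fun ρ : ℝ => Real.exp (-ρ)) (Ioi 0) := by
    intro a _ b _ h
    have := Real.exp_injective h
    linarith
  have key := integral_image_eq_integral_abs_deriv_smul measurableSet_Ioi hderiv hinj
    (fun x => x ^ (σ - 1) * Real.sqrt (1 - x))
  rw [image_exp_neg_Ioi] at key
  rw [key]
  unfold betaHalf
  refine setIntegral_congr_fun measurableSet_Ioi (fun ρ _ => ?_)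
  simp only [abs_neg, abs_of_pos (Real.exp_pos _), smul_eq_mul]
  rw [← Real.exp_mul]
  have : Real.exp (-(ρ * σ)) = Real.exp (-ρ) * Real.exp (-ρ * (σ - 1)) := by
    rw [← Real.exp_add]; ring_nf
  rw [this]
  ring

/-- **The Beta value**: `B_σ = Γ(σ) Γ(3/2) / Γ(σ + 3/2)` for `σ > 0`. [folklore] -/
theorem betaHalf_eq_Gamma (hσ : 0 < σ) :
    betaHalf σ = Real.Gamma σ * Real.Gamma (3 / 2) / Real.Gamma (σ + 3 / 2) := by
  have hB := Complex.betaIntegral_eq_Gamma_mul_div (σ : ℂ) (3 / 2 : ℂ) (by simpa using hσ)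
    (by norm_num)
  have hlhs : Complex.betaIntegral (σ : ℂ) (3 / 2 : ℂ) = ((betaHalf σ : ℝ) : ℂ) := by
    unfold Complex.betaIntegral
    rw [betaHalf_eq_integral_rpow, ← integral_Ioc_eq_integral_Ioo,
      ← intervalIntegral.integral_of_le zero_le_one, ← intervalIntegral.integral_ofReal]
    refine intervalIntegral.integral_congr (fun x hx => ?_)
    rw [uIcc_of_le zero_le_one] at hx
    have h1 : (x : ℂ) ^ ((σ : ℂ) - 1) = ((x ^ (σ - 1) : ℝ) : ℂ) := by
      rw [Complex.ofReal_cpow hx.1]; push_cast; ring_nf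
    have h2 : (1 - (x : ℂ)) ^ ((3 / 2 : ℂ) - 1) = ((Real.sqrt (1 - x) : ℝ) : ℂ) := by
      rw [Real.sqrt_eq_rpow, Complex.ofReal_cpow (by linarith [hx.2])]; push_cast; ring_nf
    rw [h1, h2]
    push_cast
    ring
  rw [hlhs] at hB
  have hrhs : Complex.Gamma (σ : ℂ) * Complex.Gamma (3 / 2 : ℂ) / Complex.Gamma ((σ : ℂ) + 3 / 2) =
      ((Real.Gamma σ * Real.Gamma (3 / 2) / Real.Gamma (σ + 3 / 2) : ℝ) : ℂ) := by
    rw [show (3 / 2 : ℂ) = ((3 / 2 : ℝ) : ℂ) by push_cast; ring,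
      show (σ : ℂ) + ((3 / 2 : ℝ) : ℂ) = ((σ + 3 / 2 : ℝ) : ℂ) by push_cast; ring,
      Complex.Gamma_ofReal, Complex.Gamma_ofReal, Complex.Gamma_ofReal]
    push_cast
    ring
  rw [hrhs] at hB
  exact_mod_cast hB

/-- `2 B(s - 1/2, 3/2) = π^{1/2} Γ(s - 1/2) / Γ(s + 1)`, the coefficient of (12.8). [folklore] -/
theorem two_mul_betaHalf_eq {s : ℝ} (hs : 1 / 2 < s) :
    2 * betaHalf (s - 1 / 2) = Real.sqrt π * Real.Gamma (s - 1 / 2) / Real.Gamma (s + 1) := by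
  rw [betaHalf_eq_Gamma (by linarith), show s - 1 / 2 + 3 / 2 = s + 1 by ring,
    show (3 / 2 : ℝ) = 1 / 2 + 1 by norm_num, Real.Gamma_add_one (by norm_num), Real.Gamma_one_half_eq]
  ring

/-! ## E. `Φ_σ(C) = ∫ e^{-rσ} (C - cosh r)_+^{3/2} dr` and `Φ_σ' = (3/2) 𝒢_σ` -/

/-- `x ↦ (x - c)_+^{3/2} = √(x - c)³` is differentiable everywhere with derivative `(3/2)√(x - c)`
(including at `x = c`, where both vanish). [folklore] -/
theorem hasDerivAt_sqrt_sub_pow_three (c x : ℝ) :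
    HasDerivAt (fun x => Real.sqrt (x - c) ^ 3) (3 / 2 * Real.sqrt (x - c)) x := by
  rcases lt_trichotomy x c with hlt | heq | hgt
  · -- locally zero
    have hzero : (fun x => Real.sqrt (x - c) ^ 3) =ᶠ[𝓝 x] fun _ => 0 := by
      filter_upwards [Iio_mem_nhds hlt] with y hy
      have hy' : y < c := hy
      rw [Real.sqrt_eq_zero'.mpr (by linarith)]; ring
    rw [Real.sqrt_eq_zero'.mpr (by linarith), mul_zero]
    exact (hasDerivAt_const x (0 : ℝ)).congr_of_eventuallyEq hzero
  · -- at the contact point: `√(y - c)³ ≤ |y - c|^{3/2} = o(y - c)`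
    subst heq
    rw [sub_self, Real.sqrt_zero, mul_zero]
    rw [hasDerivAt_iff_isLittleO]
    simp only [sub_self, Real.sqrt_zero, ne_eq, OfNat.ofNat_ne_zero, not_false_eq_true, zero_pow,
      smul_zero, sub_zero]
    rw [Asymptotics.isLittleO_iff]
    intro ε hε
    have hε2 : 0 < ε ^ 2 := by positivity
    filter_upwards [Metric.ball_mem_nhds x hε2] with y hy
    rw [Real.norm_eq_abs, Real.norm_eq_abs]
    have hdist : |y - x| < ε ^ 2 := by rwa [Metric.mem_ball, Real.dist_eq] at hy
    rcases le_or_gt y x with hyx | hyx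
    · rw [Real.sqrt_eq_zero'.mpr (by linarith)]
      simp only [ne_eq, OfNat.ofNat_ne_zero, not_false_eq_true, zero_pow, abs_zero]
      positivity
    · have h0 : 0 < y - x := by linarith
      have hs : Real.sqrt (y - x) ≤ ε := by
        rw [Real.sqrt_le_left hε.le]
        rw [abs_of_pos h0] at hdist
        linarith
      rw [abs_of_nonneg (by positivity), abs_of_pos h0, pow_succ, Real.sq_sqrt h0.le]
      calc (y - x) * Real.sqrt (y - x) ≤ (y - x) * ε := mul_le_mul_of_nonneg_left hs h0.le
        _ = ε * (y - x) := by ring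
  · have h0 : 0 < x - c := by linarith
    have h1 : HasDerivAt (fun x => Real.sqrt (x - c)) (1 / (2 * Real.sqrt (x - c))) x := by
      simpa using ((hasDerivAt_id x).sub_const c).sqrt h0.ne'
    have h2 := h1.pow 3
    refine h2.congr_deriv ?_
    have hs : Real.sqrt (x - c) ≠ 0 := (Real.sqrt_pos.mpr h0).ne'
    field_simp
    ring

/-- `Φ_σ(C) = ∫_ℝ e^{-rσ} (C - cosh r)_+^{3/2} dr`. [folklore] -/
def PhiThreeHalves (σ C : ℝ) : ℝ := ∫ r : ℝ, Real.exp (-(r * σ)) * Real.sqrt (C - cosh r) ^ 3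

/-- `𝒢_σ(C)` as an integral over `ℝ`: `∫_ℝ e^{-rσ} (C - cosh r)_+^{1/2} dr`. [folklore] -/
def GHalfLine (σ C : ℝ) : ℝ := ∫ r : ℝ, Real.exp (-(r * σ)) * Real.sqrt (C - cosh r)

/-- The support of `r ↦ √(C - cosh r)` is contained in `[-|arcosh C|… ]`: for `C ≤ cosh M`,
`√(C - cosh r) = 0` whenever `|r| ≥ M` (`M ≥ 0`). [folklore] -/
theorem sqrt_sub_cosh_eq_zero_of_le {C M r : ℝ} (hM : 0 ≤ M) (hCM : C ≤ cosh M) (hr : M ≤ |r|) :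
    Real.sqrt (C - cosh r) = 0 := by
  apply Real.sqrt_eq_zero'.mpr
  have : cosh M ≤ cosh r := by
    rw [← Real.cosh_abs r]
    exact Real.cosh_le_cosh.mpr (by rw [abs_abs, abs_of_nonneg hM]; exact hr)
  linarith

/-- Continuous functions vanishing outside `[-M, M]` are integrable. [folklore] -/
theorem integrable_of_support_subset {f : ℝ → ℝ} (hf : Continuous f) {M : ℝ}
    (hM : ∀ r, M ≤ |r| → f r = 0) : Integrable f := by
  apply hf.integrable_of_hasCompactSupport
  apply HasCompactSupport.of_support_subset_isCompact (isCompact_Icc (a := -|M| - 1) (b := |M| + 1))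
  intro r hr
  by_contra hnot
  apply hr
  apply hM
  by_contra hlt
  push Not at hlt
  apply hnot
  constructor <;> [linarith [neg_abs_le r, le_abs_self M, abs_lt.mp hlt |>.1, abs_nonneg M];
    linarith [le_abs_self r, le_abs_self M, (abs_lt.mp hlt).2, abs_nonneg M]]

/-- `e^{-rσ} (C - cosh r)_+^{1/2}` is integrable over `ℝ` (compact support). [folklore] -/
theorem integrable_exp_mul_sqrt_sub_cosh (σ C : ℝ) :
    Integrable (fun r => Real.exp (-(r * σ)) * Real.sqrt (C - cosh r)) := by
  set M := max (Real.arcosh (max C 1)) 0 with hM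
  refine integrable_of_support_subset (by fun_prop) (M := Real.arcosh (max C 1)) (fun r hr => ?_)
  rw [sqrt_sub_cosh_eq_zero_of_le (Real.arcosh_nonneg (le_max_right _ _)) ?_ hr, mul_zero]
  rw [Real.cosh_arcosh (le_max_right _ _)]; exact le_max_left _ _

/-- `e^{-rσ} (C - cosh r)_+^{3/2}` is integrable over `ℝ` (compact support). [folklore] -/
theorem integrable_exp_mul_sqrt_sub_cosh_pow (σ C : ℝ) :
    Integrable (fun r => Real.exp (-(r * σ)) * Real.sqrt (C - cosh r) ^ 3) := by
  refine integrable_of_support_subset (by fun_prop) (M := Real.arcosh (max C 1)) (fun r hr => ?_)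
  rw [sqrt_sub_cosh_eq_zero_of_le (Real.arcosh_nonneg (le_max_right _ _)) ?_ hr]
  · ring
  rw [Real.cosh_arcosh (le_max_right _ _)]; exact le_max_left _ _

/-- **`Φ_σ' = (3/2) 𝒢_σ`** (differentiation under the integral sign, dominated on `|C' - C| < 1`
by `(3/2) e^{-rσ} √(C + 1 - cosh r)`). [folklore] -/
theorem hasDerivAt_PhiThreeHalves (σ C : ℝ) :
    HasDerivAt (PhiThreeHalves σ) (3 / 2 * GHalfLine σ C) C := by
  have key := hasDerivAt_integral_of_dominated_loc_of_deriv_le (μ := volume) (x₀ := C)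
    (F := fun x r => Real.exp (-(r * σ)) * Real.sqrt (x - cosh r) ^ 3)
    (F' := fun x r => Real.exp (-(r * σ)) * (3 / 2 * Real.sqrt (x - cosh r)))
    (bound := fun r => Real.exp (-(r * σ)) * (3 / 2 * Real.sqrt (C + 1 - cosh r)))
    (s := Metric.ball C 1) (Metric.ball_mem_nhds C one_pos)
    (Eventually.of_forall fun x => (by fun_prop : Continuous fun r =>
      Real.exp (-(r * σ)) * Real.sqrt (x - cosh r) ^ 3).aestronglyMeasurable)
    (integrable_exp_mul_sqrt_sub_cosh_pow σ C)
    ((by fun_prop : Continuous fun r =>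
      Real.exp (-(r * σ)) * (3 / 2 * Real.sqrt (C - cosh r))).aestronglyMeasurable)
    (ae_of_all _ fun r x hx => by
      have hx' : x ≤ C + 1 := by
        have := Metric.mem_ball.mp hx; rw [Real.dist_eq] at this; linarith [abs_lt.mp this]
      rw [Real.norm_eq_abs, abs_of_nonneg (by positivity)]
      gcongr)
    (by
      have := (integrable_exp_mul_sqrt_sub_cosh σ (C + 1)).const_mul (3 / 2)
      refine this.congr (ae_of_all _ fun r => ?_)
      ring)
    (ae_of_all _ fun r x _ => by
      have := (hasDerivAt_sqrt_sub_pow_three (cosh r) x).const_mul (Real.exp (-(r * σ)))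
      exact this)
  have e : ∫ r, Real.exp (-(r * σ)) * (3 / 2 * Real.sqrt (C - cosh r)) = 3 / 2 * GHalfLine σ C := by
    unfold GHalfLine
    rw [← MeasureTheory.integral_const_mul]
    congr 1 with r; ring
  rw [← e]
  exact key.2

/-- `𝒢_σ` over `ℝ` equals the interval version `gHalf` (support `[-arcosh C, arcosh C]`, `C ≥ 1`). [folklore] -/
theorem GHalfLine_eq_gHalf (hC : 1 ≤ C) (σ : ℝ) : GHalfLine σ C = gHalf σ C := by
  unfold GHalfLine gHalf
  set R := Real.arcosh C with hR
  have hR0 : 0 ≤ R := Real.arcosh_nonneg hC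
  rw [intervalIntegral.integral_of_le (by linarith : -R ≤ R), ← integral_Icc_eq_integral_Ioc,
    ← setIntegral_eq_integral_of_forall_compl_eq_zero]
  intro r hr
  have h : R ≤ |r| := le_of_not_gt fun hlt => hr ⟨(abs_lt.mp hlt).1.le, (abs_lt.mp hlt).2.le⟩
  rw [sqrt_sub_cosh_eq_zero_of_le hR0 (by rw [hR, Real.cosh_arcosh hC]) h, mul_zero]

/-- `𝒢_σ` is monotone in `C`. [folklore] -/
theorem GHalfLine_mono (σ : ℝ) : Monotone (GHalfLine σ) := by
  intro C C' h
  unfold GHalfLine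
  apply integral_mono (integrable_exp_mul_sqrt_sub_cosh σ C) (integrable_exp_mul_sqrt_sub_cosh σ C')
  intro r
  simp only
  gcongr

/-- **`Φ_σ(C_b) - Φ_σ(C_a) = (3/2) ∫_{C_a}^{C_b} 𝒢_σ(C) dC`.** [folklore] -/
theorem PhiThreeHalves_sub (σ : ℝ) {a b : ℝ} :
    PhiThreeHalves σ b - PhiThreeHalves σ a = ∫ C in a..b, 3 / 2 * GHalfLine σ C := by
  rw [intervalIntegral.integral_eq_sub_of_hasDerivAt (fun C _ => hasDerivAt_PhiThreeHalves σ C)]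
  exact ((GHalfLine_mono σ).intervalIntegrable.const_mul (3 / 2))

/-! ## F. The pointwise asymptotics of `𝒢_σ(C)` and the integrated main term -/

variable {s : ℝ}

/-- `(2C)^s - E^s ≤ 1` for `E ∈ [2C - 1/C, 2C]`, `C ≥ 1`, `0 ≤ s ≤ 1` (Bernoulli). [folklore] -/
theorem rpow_two_mul_sub_rpow_le {E : ℝ} (hC : 1 ≤ C) (hE1 : 2 * C - C⁻¹ ≤ E) (hE2 : E ≤ 2 * C)
    (hs0 : 0 ≤ s) (hs1 : s ≤ 1) : |E ^ s - (2 * C) ^ s| ≤ 1 := by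
  have hC0 : 0 < C := by linarith
  have hCinv : C⁻¹ ≤ 1 := inv_le_one_of_one_le₀ hC
  have hCinv0 : 0 < C⁻¹ := inv_pos.mpr hC0
  set a := 2 * C - C⁻¹ with ha
  have ha1 : 1 ≤ a := by rw [ha]; linarith
  have ha0 : 0 < a := by linarith
  have hE0 : 0 ≤ E := by linarith
  have hmono1 : E ^ s ≤ (2 * C) ^ s := Real.rpow_le_rpow hE0 hE2 hs0
  have hmono2 : a ^ s ≤ E ^ s := Real.rpow_le_rpow ha0.le hE1 hs0
  -- Bernoulli: `(2C)^s = (a (1 + δ))^s ≤ a^s (1 + s δ)`, `δ = C⁻¹ / a`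
  set δ := C⁻¹ / a with hδ
  have hδ0 : 0 ≤ δ := div_nonneg hCinv0.le ha0.le
  have haδ : a * δ = C⁻¹ := by rw [hδ]; field_simp
  have h2C : 2 * C = a * (1 + δ) := by rw [mul_add, mul_one, haδ, ha]; ring
  have hstep : a ^ s * δ = a ^ (s - 1) * C⁻¹ := by
    rw [Real.rpow_sub_one ha0.ne', ← haδ]; field_simp
  have hbern : (1 + δ) ^ s ≤ 1 + s * δ := rpow_one_add_le_one_add_mul_self (by linarith) hs0 hs1
  have hkey : (2 * C) ^ s ≤ a ^ s + 1 := by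
    rw [h2C, Real.mul_rpow ha0.le (by linarith)]
    have has1 : a ^ (s - 1) ≤ 1 := Real.rpow_le_one_of_one_le_of_nonpos ha1 (by linarith)
    have has0 : 0 ≤ a ^ s := Real.rpow_nonneg ha0.le s
    calc a ^ s * (1 + δ) ^ s ≤ a ^ s * (1 + s * δ) := mul_le_mul_of_nonneg_left hbern has0
      _ = a ^ s + s * (a ^ s * δ) := by ring
      _ = a ^ s + s * (a ^ (s - 1) * C⁻¹) := by rw [hstep]
      _ ≤ a ^ s + 1 * (1 * 1) := by gcongr
      _ = a ^ s + 1 := by ring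
  rw [abs_le]
  constructor <;> linarith

/-- **Pointwise asymptotics**: for `C ≥ 1`, `σ = s - 1/2 ∈ (0, 1/2]`,
`|𝒢_σ(C) - 2^{-1/2} B_σ (2C)^s| ≤ B_σ + 2 (1/σ + 1/(1-σ)) C^{1-s}`. [folklore] -/
theorem gHalf_asymp (hs : 1 / 2 < s) (hs1 : s ≤ 1) (hC : 1 ≤ C) :
    |gHalf (s - 1 / 2) C - 1 / Real.sqrt 2 * betaHalf (s - 1 / 2) * (2 * C) ^ s| ≤
      betaHalf (s - 1 / 2) + 2 * (1 / (s - 1 / 2) + 1 / (1 - (s - 1 / 2))) * C ^ (1 - s) := by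
  set σ := s - 1 / 2 with hσdef
  have hσ : 0 < σ := by rw [hσdef]; linarith
  have hσ1 : σ < 1 := by rw [hσdef]; linarith
  have hσle : σ ≤ 1 / 2 := by rw [hσdef]; linarith
  set R := Real.arcosh C with hR
  set E := Real.exp R with hE
  set B := betaHalf σ with hB
  set Kσ := 1 / σ + 1 / (1 - σ) with hK
  have hR0 : 0 ≤ R := Real.arcosh_nonneg hC
  have hC0 : 0 < C := by linarith
  have hE0 : 0 < E := Real.exp_pos _
  have hEC : C ≤ E := by rw [hE, hR]; exact le_exp_arcosh hC
  have hE1 : 1 ≤ E := hC.trans hEC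
  have hE2C : E ≤ 2 * C := by rw [hE, hR]; exact exp_arcosh_le hC
  have hElow : 2 * C - C⁻¹ ≤ E := by rw [hE, hR]; exact two_mul_sub_inv_le_exp_arcosh hC
  have hB0 : 0 ≤ B := by
    rw [hB]; unfold betaHalf
    exact setIntegral_nonneg measurableSet_Ioi (fun ρ _ => mul_nonneg (Real.exp_pos _).le (Real.sqrt_nonneg _))
  have h1σ : 0 < 1 - σ := by linarith
  have hK0 : 0 ≤ Kσ := by
    rw [hK]; exact add_nonneg (one_div_nonneg.mpr hσ.le) (one_div_nonneg.mpr h1σ.le)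
  -- the truncation error `θ`
  set θ := B - betaTrunc σ (2 * R) with hθ
  have h2R : 0 ≤ 2 * R := by linarith
  obtain ⟨ht1, ht2⟩ := betaHalf_sub_trunc hσ h2R
  obtain ⟨hu1, hu2⟩ := trunc_sub_betaTrunc hσ1 h2R
  have hθ0 : 0 ≤ θ := by rw [hθ, hB]; linarith
  have hθ1 : θ ≤ Real.exp (-(2 * R * σ)) * Kσ := by
    rw [hθ, hB, hK, mul_add, mul_one_div, mul_one_div]; linarith
  -- `𝒢 = (1/√2) E^s (B - θ)`
  have hG : gHalf σ C = 1 / Real.sqrt 2 * E ^ s * (B - θ) := by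
    rw [gHalf_eq hC σ, ← hR, ← hE, hθ]
    have h1 : Real.sqrt (E / 2) = E ^ (1 / 2 : ℝ) / Real.sqrt 2 := by
      rw [Real.sqrt_div' _ (by norm_num : (0:ℝ) ≤ 2), Real.sqrt_eq_rpow]
    have h2 : Real.exp (R * σ) = E ^ σ := by rw [hE, Real.exp_mul]
    have h3 : E ^ (1 / 2 : ℝ) * E ^ σ = E ^ s := by
      rw [← Real.rpow_add hE0]; congr 1; rw [hσdef]; ring
    rw [h1, h2]
    calc E ^ (1 / 2 : ℝ) / Real.sqrt 2 * E ^ σ * betaTrunc σ (2 * R)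
        = 1 / Real.sqrt 2 * (E ^ (1 / 2 : ℝ) * E ^ σ) * betaTrunc σ (2 * R) := by ring
      _ = _ := by rw [h3]; ring
  -- `E^s θ ≤ 2 Kσ C^{1-s}`
  have hEs0 : 0 ≤ E ^ s := Real.rpow_nonneg hE0.le s
  have hEsθ : E ^ s * θ ≤ 2 * Kσ * C ^ (1 - s) := by
    have hexp : Real.exp (-(2 * R * σ)) = E ^ (-(2 * σ)) := by
      rw [hE, ← Real.exp_mul]; congr 1; ring
    have h1 : E ^ (-(2 * σ)) ≤ C ^ (-(2 * σ)) :=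
      Real.rpow_le_rpow_of_nonpos hC0 hEC (by linarith)
    have h2 : E ^ s ≤ (2 * C) ^ s := Real.rpow_le_rpow hE0.le hE2C (by linarith)
    have h3 : (2 * C) ^ s ≤ 2 * C ^ s := by
      rw [Real.mul_rpow (by norm_num) hC0.le]
      have : (2 : ℝ) ^ s ≤ 2 ^ (1 : ℝ) := Real.rpow_le_rpow_of_exponent_le (by norm_num) hs1
      rw [Real.rpow_one] at this
      exact mul_le_mul_of_nonneg_right this (Real.rpow_nonneg hC0.le s)
    have h4 : C ^ s * C ^ (-(2 * σ)) = C ^ (1 - s) := by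
      rw [← Real.rpow_add hC0]; congr 1; rw [hσdef]; ring
    calc E ^ s * θ ≤ E ^ s * (Real.exp (-(2 * R * σ)) * Kσ) := mul_le_mul_of_nonneg_left hθ1 hEs0
      _ = E ^ s * E ^ (-(2 * σ)) * Kσ := by rw [hexp]; ring
      _ ≤ (2 * C ^ s) * C ^ (-(2 * σ)) * Kσ := by
          apply mul_le_mul_of_nonneg_right _ hK0
          exact mul_le_mul (h2.trans h3) h1 (Real.rpow_nonneg hE0.le _)
            (mul_nonneg zero_le_two (Real.rpow_nonneg hC0.le s))
      _ = 2 * Kσ * C ^ (1 - s) := by rw [← h4]; ring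
  -- `|E^s - (2C)^s| ≤ 1`
  have hdiff := rpow_two_mul_sub_rpow_le hC hElow hE2C (by linarith) hs1
  -- assemble
  have hs2 : 0 < Real.sqrt 2 := by positivity
  have hs2' : 1 / Real.sqrt 2 ≤ 1 := by
    rw [div_le_one hs2]; exact Real.one_le_sqrt.mpr (by norm_num)
  have e : gHalf σ C - 1 / Real.sqrt 2 * B * (2 * C) ^ s =
      1 / Real.sqrt 2 * (B * (E ^ s - (2 * C) ^ s) - E ^ s * θ) := by rw [hG]; ring
  rw [e, abs_mul, abs_of_pos (by positivity : 0 < 1 / Real.sqrt 2)]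
  calc 1 / Real.sqrt 2 * |B * (E ^ s - (2 * C) ^ s) - E ^ s * θ|
      ≤ 1 * |B * (E ^ s - (2 * C) ^ s) - E ^ s * θ| :=
        mul_le_mul_of_nonneg_right hs2' (abs_nonneg _)
    _ ≤ |B * (E ^ s - (2 * C) ^ s)| + |E ^ s * θ| := by rw [one_mul]; exact abs_sub _ _
    _ ≤ B * 1 + 2 * Kσ * C ^ (1 - s) := by
        apply add_le_add
        · rw [abs_mul, abs_of_nonneg hB0]; exact mul_le_mul_of_nonneg_left hdiff hB0
        · rw [abs_of_nonneg (mul_nonneg hEs0 hθ0)]; exact hEsθ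
    _ = _ := by ring

/-- `1/√2 = √2/2`. [folklore] -/
theorem one_div_sqrt_two : 1 / Real.sqrt 2 = Real.sqrt 2 / 2 := by
  rw [eq_div_iff two_ne_zero, one_div, inv_mul_eq_div, Real.div_sqrt]

/-- `(X + Y)^s ≤ X^s + Y X^{s-1}` for `X > 0`, `Y ≥ 0`, `0 ≤ s ≤ 1` (Bernoulli). [folklore] -/
theorem rpow_add_le_add_mul_rpow {X Y : ℝ} (hX : 0 < X) (hY : 0 ≤ Y) (hs0 : 0 ≤ s) (hs1 : s ≤ 1) :
    (X + Y) ^ s ≤ X ^ s + Y * X ^ (s - 1) := by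
  have h1 : X + Y = X * (1 + Y / X) := by field_simp
  have hb : (1 + Y / X) ^ s ≤ 1 + s * (Y / X) :=
    rpow_one_add_le_one_add_mul_self (by have := div_nonneg hY hX.le; linarith) hs0 hs1
  rw [h1, Real.mul_rpow hX.le (by positivity)]
  have hXs : 0 ≤ X ^ s := Real.rpow_nonneg hX.le s
  calc X ^ s * (1 + Y / X) ^ s ≤ X ^ s * (1 + s * (Y / X)) := mul_le_mul_of_nonneg_left hb hXs
    _ = X ^ s + s * (Y * (X ^ s / X)) := by ring
    _ = X ^ s + s * (Y * X ^ (s - 1)) := by rw [Real.rpow_sub_one hX.ne']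
    _ ≤ X ^ s + 1 * (Y * X ^ (s - 1)) := by gcongr
    _ = X ^ s + Y * X ^ (s - 1) := by ring

/-- **(12.8) in real form.** For `1/2 < s ≤ 1` there is `K` with
`|(16/(3Y√2)) (Φ_σ((X+Y)/2) - Φ_σ(X/2)) - 2 B_σ X^s| ≤ K (Y + X^{1/2})` for all `X ≥ 2Y ≥ 2`,
`σ = s - 1/2`. [folklore] -/
theorem eq_12_8_real (hs : 1 / 2 < s) (hs1 : s ≤ 1) :
    ∃ K : ℝ, ∀ X Y : ℝ, 1 ≤ Y → 2 * Y ≤ X →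
      |16 / (3 * Y * Real.sqrt 2) *
          (PhiThreeHalves (s - 1 / 2) ((X + Y) / 2) - PhiThreeHalves (s - 1 / 2) (X / 2)) -
        2 * betaHalf (s - 1 / 2) * X ^ s| ≤ K * (Y + X ^ (1 / 2 : ℝ)) := by
  set σ := s - 1 / 2 with hσdef
  have hσ : 0 < σ := by rw [hσdef]; linarith
  have hσ1 : σ < 1 := by rw [hσdef]; linarith
  set B := betaHalf σ with hB
  set Kσ := 1 / σ + 1 / (1 - σ) with hK
  have hB0 : 0 ≤ B := by
    rw [hB]; unfold betaHalf
    exact setIntegral_nonneg measurableSet_Ioi (fun ρ _ => mul_nonneg (Real.exp_pos _).le (Real.sqrt_nonneg _))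
  have h1σ : 0 < 1 - σ := by linarith
  have hK0 : 0 ≤ Kσ := by
    rw [hK]; exact add_nonneg (one_div_nonneg.mpr hσ.le) (one_div_nonneg.mpr h1σ.le)
  have hs2 : 0 < Real.sqrt 2 := by positivity
  refine ⟨2 * Real.sqrt 2 * B + 2 * B + 4 * Real.sqrt 2 * Kσ, fun X Y hY hXY => ?_⟩
  have hX2 : 2 ≤ X := by linarith
  have hX0 : 0 < X := by linarith
  have hX1 : 1 ≤ X := by linarith
  have hY0 : 0 < Y := by linarith
  set Ca := X / 2 with hCa
  set Cb := (X + Y) / 2 with hCb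
  have hCa1 : 1 ≤ Ca := by rw [hCa]; linarith
  have hab : Ca ≤ Cb := by rw [hCa, hCb]; linarith
  have hlen : Cb - Ca = Y / 2 := by rw [hCa, hCb]; ring
  have hCbX : Cb ≤ X := by rw [hCb]; linarith
  -- Step 1: `Φ_b - Φ_a = ∫ (3/2) G`
  have hΦ := PhiThreeHalves_sub σ (a := Ca) (b := Cb)
  -- Step 2: pointwise bound on `Ι Ca Cb`
  have hX1s : X ^ (1 - s) ≤ X ^ (1 / 2 : ℝ) := Real.rpow_le_rpow_of_exponent_le hX1 (by linarith)
  have hpt : ∀ C ∈ uIoc Ca Cb, |3 / 2 * GHalfLine σ C - 3 / 2 * (1 / Real.sqrt 2 * B * (2 * C) ^ s)| ≤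
      3 / 2 * (B + 2 * Kσ * X ^ (1 - s)) := by
    intro C hC
    rw [uIoc_of_le hab] at hC
    have hC1 : 1 ≤ C := hCa1.trans hC.1.le
    have hCX : C ≤ X := hC.2.trans hCbX
    rw [← mul_sub, abs_mul, abs_of_pos (by norm_num : (0:ℝ) < 3 / 2)]
    refine mul_le_mul_of_nonneg_left ?_ (by norm_num)
    rw [GHalfLine_eq_gHalf hC1]
    have h := gHalf_asymp hs hs1 hC1
    rw [← hσdef] at h
    have hmono : C ^ (1 - s) ≤ X ^ (1 - s) := Real.rpow_le_rpow (by linarith) hCX (by linarith)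
    calc |gHalf σ C - 1 / Real.sqrt 2 * B * (2 * C) ^ s| ≤ B + 2 * Kσ * C ^ (1 - s) := h
      _ ≤ B + 2 * Kσ * X ^ (1 - s) := by gcongr
  -- integrability
  have hGint : IntervalIntegrable (fun C => 3 / 2 * GHalfLine σ C) volume Ca Cb :=
    ((GHalfLine_mono σ).intervalIntegrable.const_mul (3 / 2))
  have hPint : IntervalIntegrable (fun C : ℝ => 3 / 2 * (1 / Real.sqrt 2 * B * (2 * C) ^ s)) volume Ca Cb := by
    apply ContinuousOn.intervalIntegrable
    apply ContinuousOn.mul continuousOn_const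
    apply ContinuousOn.mul continuousOn_const
    apply ContinuousOn.rpow_const (by fun_prop)
    intro C hC
    right; linarith
  -- Step 3: `I₁`
  have hI1 : |(∫ C in Ca..Cb, 3 / 2 * GHalfLine σ C) -
      ∫ C in Ca..Cb, 3 / 2 * (1 / Real.sqrt 2 * B * (2 * C) ^ s)| ≤
      3 / 2 * (B + 2 * Kσ * X ^ (1 - s)) * (Y / 2) := by
    rw [← intervalIntegral.integral_sub hGint hPint, ← hlen, ← abs_of_nonneg (by linarith : 0 ≤ Cb - Ca)]
    have := intervalIntegral.norm_integral_le_of_norm_le_const (a := Ca) (b := Cb)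
      (f := fun C => 3 / 2 * GHalfLine σ C - 3 / 2 * (1 / Real.sqrt 2 * B * (2 * C) ^ s))
      (C := 3 / 2 * (B + 2 * Kσ * X ^ (1 - s))) (fun C hC => by
        rw [Real.norm_eq_abs]; exact hpt C hC)
    rw [Real.norm_eq_abs] at this
    exact this
  -- Step 4: `I₂`
  have hI2 : |(∫ C in Ca..Cb, (2 * C) ^ s) - Y / 2 * X ^ s| ≤ Y * X ^ (s - 1) * (Y / 2) := by
    have hconst : ∫ _ in Ca..Cb, X ^ s = Y / 2 * X ^ s := by
      rw [intervalIntegral.integral_const, hlen, smul_eq_mul]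
    have hcint : IntervalIntegrable (fun C : ℝ => (2 * C) ^ s) volume Ca Cb := by
      apply ContinuousOn.intervalIntegrable
      apply ContinuousOn.rpow_const (by fun_prop)
      intro C hC; right; linarith
    rw [← hconst, ← intervalIntegral.integral_sub hcint intervalIntegrable_const, ← hlen,
      ← abs_of_nonneg (by linarith : 0 ≤ Cb - Ca)]
    have := intervalIntegral.norm_integral_le_of_norm_le_const (a := Ca) (b := Cb)
      (f := fun C => (2 * C) ^ s - X ^ s) (C := Y * X ^ (s - 1)) (fun C hC => by
        rw [uIoc_of_le hab] at hC
        have h2C : X ≤ 2 * C := by rw [hCa] at hC; linarith [hC.1]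
        have h2C' : 2 * C ≤ X + Y := by rw [hCb] at hC; linarith [hC.2]
        have hlow : X ^ s ≤ (2 * C) ^ s := Real.rpow_le_rpow hX0.le h2C (by linarith)
        have hup : (2 * C) ^ s ≤ X ^ s + Y * X ^ (s - 1) :=
          (Real.rpow_le_rpow (by linarith) h2C' (by linarith)).trans
            (rpow_add_le_add_mul_rpow hX0 hY0.le (by linarith) hs1)
        rw [Real.norm_eq_abs, abs_of_nonneg (by linarith)]
        linarith)
    rw [Real.norm_eq_abs] at this
    exact this
  -- Step 5: combine
  have hsplit : ∫ C in Ca..Cb, 3 / 2 * (1 / Real.sqrt 2 * B * (2 * C) ^ s) =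
      3 / 2 * (1 / Real.sqrt 2 * B) * ∫ C in Ca..Cb, (2 * C) ^ s := by
    rw [← intervalIntegral.integral_const_mul]
    congr 1 with C; ring
  have hc : 16 / (3 * Y * Real.sqrt 2) * (3 / 2 * (1 / Real.sqrt 2 * B)) = 4 * B / Y := by
    rw [one_div_sqrt_two]; field_simp; ring
  have hXs1 : X ^ (s - 1) ≤ 1 := Real.rpow_le_one_of_one_le_of_nonpos hX1 (by linarith)
  have hXhalf : 0 ≤ X ^ (1 / 2 : ℝ) := Real.rpow_nonneg hX0.le _
  have hXs0 : 0 ≤ X ^ (s - 1) := Real.rpow_nonneg hX0.le _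
  -- rewrite the target as `c I₁ + (4B/Y) I₂`
  have key : 16 / (3 * Y * Real.sqrt 2) * (PhiThreeHalves σ ((X + Y) / 2) - PhiThreeHalves σ (X / 2)) -
      2 * B * X ^ s =
      16 / (3 * Y * Real.sqrt 2) * ((∫ C in Ca..Cb, 3 / 2 * GHalfLine σ C) -
        ∫ C in Ca..Cb, 3 / 2 * (1 / Real.sqrt 2 * B * (2 * C) ^ s)) +
      4 * B / Y * ((∫ C in Ca..Cb, (2 * C) ^ s) - Y / 2 * X ^ s) := by
    rw [← hCa, ← hCb, hΦ, hsplit, mul_sub, mul_sub, ← mul_assoc (16 / (3 * Y * Real.sqrt 2)), hc]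
    field_simp
    ring
  rw [key]
  have hcpos : 0 < 16 / (3 * Y * Real.sqrt 2) := by positivity
  calc |16 / (3 * Y * Real.sqrt 2) * ((∫ C in Ca..Cb, 3 / 2 * GHalfLine σ C) -
          ∫ C in Ca..Cb, 3 / 2 * (1 / Real.sqrt 2 * B * (2 * C) ^ s)) +
        4 * B / Y * ((∫ C in Ca..Cb, (2 * C) ^ s) - Y / 2 * X ^ s)|
      ≤ 16 / (3 * Y * Real.sqrt 2) * (3 / 2 * (B + 2 * Kσ * X ^ (1 - s)) * (Y / 2)) +
        4 * B / Y * (Y * X ^ (s - 1) * (Y / 2)) := by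
        refine (abs_add_le _ _).trans (add_le_add ?_ ?_)
        · rw [abs_mul, abs_of_pos hcpos]; exact mul_le_mul_of_nonneg_left hI1 hcpos.le
        · rw [abs_mul, abs_of_nonneg (by positivity)]; exact mul_le_mul_of_nonneg_left hI2 (by positivity)
    _ = 4 / Real.sqrt 2 * (B + 2 * Kσ * X ^ (1 - s)) + 2 * B * Y * X ^ (s - 1) := by
        field_simp; ring
    _ = 2 * Real.sqrt 2 * (B + 2 * Kσ * X ^ (1 - s)) + 2 * B * Y * X ^ (s - 1) := by
        rw [show 4 / Real.sqrt 2 = 4 * (1 / Real.sqrt 2) by ring, one_div_sqrt_two]; ring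
    _ ≤ 2 * Real.sqrt 2 * (B * Y + 2 * Kσ * X ^ (1 / 2 : ℝ)) + 2 * B * Y * 1 := by
        gcongr
        exact le_mul_of_one_le_right hB0 hY
    _ ≤ (2 * Real.sqrt 2 * B + 2 * B + 4 * Real.sqrt 2 * Kσ) * (Y + X ^ (1 / 2 : ℝ)) := by
        nlinarith [mul_nonneg hB0 hXhalf, mul_nonneg hK0 hY0.le, hs2.le, mul_nonneg (mul_nonneg hs2.le hK0) hY0.le,
          mul_nonneg (mul_nonneg hs2.le hB0) hXhalf]

end SelbergDecay

namespace SelbergDecay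

/-- At `t = iσ` the Fourier integral of `f_R` is the real Laplace-type integral `Φ_σ(cosh R)`:
`F_R(iσ) = ∫ e^{-rσ} (cosh R - cosh r)_+^{3/2} dr`. [folklore] -/
theorem coshKernelFourier_I_mul {R : ℝ} (hR : 0 ≤ R) (σ : ℝ) :
    coshKernelFourier R (Complex.I * σ) = ((PhiThreeHalves σ (Real.cosh R) : ℝ) : ℂ) := by
  rw [← integral_cexp_mul_coshKernel hR]
  unfold PhiThreeHalves coshKernel
  rw [← integral_complex_ofReal]
  congr 1 with r
  have e : Complex.I * (r : ℂ) * (Complex.I * (σ : ℂ)) = ((-(r * σ) : ℝ) : ℂ) := by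
    push_cast
    ring_nf
    rw [Complex.I_sq]
    ring
  rw [e, ← Complex.ofReal_exp]
  push_cast
  ring

end SelbergDecay

open SelbergDecay in
/-- **Iwaniec (12.8), proved** (discharge of `Iwaniec2002_eq_12_8`): for `1/2 < s ≤ 1` and
`X ≥ 2Y ≥ 2`, `h(i(s - 1/2)) = π^{1/2} Γ(s - 1/2)/Γ(s + 1) X^s + O_s(Y + X^{1/2})` for the
transform `h` of the kernel of Fig. 11. Proof: the closed form `h = (16/(3√2 Y))(F_{R_b} - F_{R_a})`
(part I.4), `F_R(iσ) = Φ_σ(cosh R)`, `Φ_σ' = (3/2) 𝒢_σ`, the exact factorisation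
`C - cosh r = (e^R/2)(1 - e^{r-R})(1 - e^{-r-R})` reducing `𝒢_σ(C)` to a truncated Beta integral,
`B(σ, 3/2) = Γ(σ)Γ(3/2)/Γ(σ + 3/2)`, and `2 B(s - 1/2, 3/2) = π^{1/2} Γ(s - 1/2)/Γ(s + 1)`.
[cite: Iwaniec2002, (12.8), PDF p. 126] -/
theorem Iwaniec2002_eq_12_8_holds : Iwaniec2002_eq_12_8 := by
  intro s hs hs1
  obtain ⟨K, hK⟩ := eq_12_8_real hs hs1
  refine ⟨K, fun X Y hY hXY => ?_⟩
  have hX : 2 ≤ X := by linarith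
  have hY0 : 0 < Y := by linarith
  have h := hK X Y hY hXY
  rw [selbergTransform_latticeKernel hX hY0,
    coshKernelFourier_I_mul (Real.arcosh_nonneg (by linarith)) (s - 1 / 2),
    coshKernelFourier_I_mul (Real.arcosh_nonneg (by linarith)) (s - 1 / 2),
    Real.cosh_arcosh (by linarith), Real.cosh_arcosh (by linarith)]
  have e : ((16 / (3 * Y * Real.sqrt 2) : ℝ) : ℂ) *
      (((PhiThreeHalves (s - 1 / 2) ((X + Y) / 2) : ℝ) : ℂ) - ((PhiThreeHalves (s - 1 / 2) (X / 2) : ℝ) : ℂ)) -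
      ((Real.sqrt π * Real.Gamma (s - 1 / 2) / Real.Gamma (s + 1) * X ^ s : ℝ) : ℂ) =
      ((16 / (3 * Y * Real.sqrt 2) * (PhiThreeHalves (s - 1 / 2) ((X + Y) / 2) - PhiThreeHalves (s - 1 / 2) (X / 2)) -
        2 * betaHalf (s - 1 / 2) * X ^ s : ℝ) : ℂ) := by
    rw [← two_mul_betaHalf_eq hs]; push_cast; ring
  rw [e, Complex.norm_real, Real.norm_eq_abs]
  exact h

end Literature.NumberTheory.Automorphic
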